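import Literature.Probability.RandomPlanarGeometry.HexSAWPolygonJoinAssembly
import Literature.Probability.RandomPlanarGeometry.HexSAWPolygonJoinDecode
import Literature.Probability.RandomPlanarGeometry.SAWPolygonTraversal
import Literature.Probability.RandomPlanarGeometry.HexSAWPolygonStaggeredCut
import Literature.Probability.RandomPlanarGeometry.HexSAWPolygonJunctionUniqueT3
import Literature.Probability.RandomPlanarGeometry.HexSAWPolygonJunctionUniqueT5
import HarnessLib

/-!
# ONE-CAR EDITION «HEX-MADRAS-EXPONENT» (lane «pcv-sawmu», a-p4 g14; lead r18 one-car rule): Madras' `θ ≥ 1/2` on the honeycomb lattice —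
`q_N(ℍ) ≤ A · N^{−1/2} · √(2+√2)^N`, with its logarithmic and rooted forms — the three junction-uniqueness modules JU1 / JU2 / JU4 of a-p4 g13
carried VERBATIM in front: part 1 = `HexSAWPolygonJunctionUniqueT1` ed.1 e2995c6835ffcd4e (`ju1`), part 2 = `HexSAWPolygonJunctionUniqueT2` ed.1
16be65ee5c7bb255 (`ju2`), part 3 = `HexSAWPolygonJunctionUniqueT4` ed.1 d312bc169937f131 (`ju4`), part 4 = `HexSAWPolygonMadrasExponent` ed.4
866c1eac0eb55b04 (`Assembly.junctionUnique := ⟨ju1, ju2, ju3, ju4, ju5⟩`, **`HexBW.hexPolygonNumber_le_rpow_half`**, `HexBW.log_hexPolygonNumber_le`,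
`HexBW.card_saLoops_le_sqrt_mul_pow`); `ju3`, `ju5` are imported (`HexSAWPolygonJunctionUniqueT3`, `…T5`).  Each part keeps its own module
docstring (as a section comment) and its own `noncomputable section … end`.
-/

/-!
# Junction uniqueness for the one-brick join (JU1 of LINE «HEX-MADRAS»): a T1 decomposition imposes the tree's `IsBrickCut` on every traversal

Topic `Literature/Probability/RandomPlanarGeometry` (lane «pcv-sawmu», a-p4 g13; design note `DESIGN-E5a-junction-uniqueness.md`).  Inputs: the T1
bundle `IsT1` and `Corridor` (`HexSAWPolygonJunctionCover/JoinAssembly`), the one-brick join `brickJoin` (`HexSAWPolygonJunctions`), the tree's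
row-separated brick cut `IsBrickCut` and its uniqueness `isBrickCut_unique` (`HexSAWPolygonJoinDecode`, p376442), and polygon traversals
(`SAWPolygonTraversal`: `IsPolyTraversal`, `follows_path`).

* **`isBrickCut_of_isT1`** — if `(P, Q, t)` is a T1 decomposition of `J = brickJoin t P Q` (corridor-separated `n`-gons) and `u` is a traversal of `J`
  entering `t` from the middle site `t + (1,0)` (`u 0 = t + (1,0)`, `u 1 = t`), then `u` reads the `P`-arc, the lower connector, the `Q`-arc and the
  upper connector in this order: `IsBrickCut (n+1) u 1`.

Source frame: A. Hammond, arXiv:1504.05286v5, §4.2 pp. 20–24 (the junction plaquette is recognised inside the joined polygon); N. Madras, J. Stat.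
Phys. 78 (1995) §2.
-/

noncomputable section

open SimpleGraph Finset Literature.Probability.LatticeModels Literature.Probability.Percolation
open Literature.Barriers.CriticalPhenomena.SupercriticalSAW (shiftEdges card_shiftEdges mem_shiftEdges_iff shiftEdges_injective)
open Literature.Probability.Percolation.SiteGadgetSystem (vertsOf mem_vertsOf)

namespace Literature.Probability.RandomPlanarGeometry.SAW

namespace HexBW

namespace Assembly

variable {P Q : Finset (Sym2 (Site 2))} {t : Site 2} {n : ℕ} {u : ℕ → Site 2}

/-- `![a, b] 0 = a` (private plumbing). [folklore] -/
@[simp] private theorem uv0 (a b : ℤ) : (![a, b] : Site 2) 0 = a := rfl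
/-- `![a, b] 1 = b` (private plumbing). [folklore] -/
@[simp] private theorem uv1 (a b : ℤ) : (![a, b] : Site 2) 1 = b := rfl

/-- membership of the six relevant bonds in the one-brick join (private plumbing). [cite: Hammond2015SAPJoining, Definition 4.3 p. 20 (arXiv v5)] -/
private theorem mem_brickJoin_iff {e : Sym2 (Site 2)} :
    e ∈ brickJoin t P Q ↔ (e ∈ P ∧ e ≠ s(t + ![0, 0], t + ![0, -1])) ∨ (e ∈ Q ∧ e ≠ s(t + ![2, 0], t + ![2, -1])) ∨
      e = s(t + ![0, 0], t + ![1, 0]) ∨ e = s(t + ![1, 0], t + ![2, 0]) ∨ e = s(t + ![0, -1], t + ![1, -1]) ∨ e = s(t + ![1, -1], t + ![2, -1]) := by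
  unfold brickJoin
  simp only [Finset.mem_union, Finset.mem_erase, Finset.mem_insert, Finset.mem_singleton]
  tauto

/-- the next site of a traversal at a vertex with two known polygon bonds (private plumbing). [cite: MadrasSlade1993, Definition 3.2.1 p. 62 (degree two)] -/
private theorem next_eq {E : Finset (Sym2 (Site 2))} {L : ℕ} (hu : IsPolyTraversal brickWallGraph E L u) (hE : IsPolygon brickWallGraph E)
    {i : ℕ} {x y : Site 2} (hx : s(u (i + 1), x) ∈ E) (hy : s(u (i + 1), y) ∈ E) (hxy : x ≠ y) (hprev : u i = x) :
    u (i + 2) = y := by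
  have hm : s(u (i + 1), u (i + 1 + 1)) ∈ E := hu.mem (i + 1)
  rcases hE.eq_or_eq_of_mem hx hy hxy hm with h | h
  · exact absurd (h.trans hprev.symm) (hu.ne_succ_succ i)
  · exact h

/-- `IsBrickCut` from the values at the six junction indices (private plumbing; indices written exactly as in the definition).
[cite: Hammond2015SAPJoining, Definition 4.3 p. 20 (arXiv v5)] -/
private theorem isBrickCut_of_eqs {M j : ℕ} {v : ℕ → Site 2} (p : Site 2) (h0 : v j = p + ![0, 0])
    (h1 : v (j + 2 * M - 1) = p + ![1, 0]) (h2 : v (j + 2 * M - 2) = p + ![2, 0]) (h3 : v (j + M - 2) = p + ![0, -1])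
    (h4 : v (j + M - 1) = p + ![1, -1]) (h5 : v (j + M) = p + ![2, -1])
    (sep : ∀ a b : ℕ, j ≤ a → a < j + M → j + M ≤ b → b < j + 2 * M → v a 1 = v b 1 → v a 0 < v b 0) : IsBrickCut M v j := by
  refine ⟨⟨?_, ?_⟩, ⟨?_, ?_⟩, ⟨?_, ?_⟩, ⟨?_, ?_⟩, ⟨?_, ?_⟩, sep⟩
  · rw [h1, h0]; simp
  · rw [h1, h0]; simp
  · rw [h2, h0]; simp
  · rw [h2, h0]; simp
  · rw [h3, h0]; simp
  · left; rw [h3, h0]; simp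
  · rw [h4, h3]; simp
  · rw [h4, h3]; simp
  · rw [h5, h3]; simp
  · rw [h5, h3]; simp

/-- **A T1 decomposition imposes the brick cut on every traversal of the joined polygon** that enters the contact site `t` from the middle site
`t + (1,0)`: the traversal then reads the `P`-arc (`n − 1` bonds), the lower connector, the `Q`-arc, the upper connector — `IsBrickCut (n+1) u 1`.
[cite: Hammond2015SAPJoining, §4.2 pp. 20–24 (arXiv v5: recognising the junction plaquette); Madras1995LatticeAnimalsExponent, §2] -/
theorem isBrickCut_of_isT1 (hP : IsPolygon brickWallGraph P) (hQ : IsPolygon brickWallGraph Q) (hPn : #P = n) (hQn : #Q = n) (hn : 3 ≤ n)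
    (hK1 : Corridor P Q) (h : IsT1 P Q t) (hu : IsPolyTraversal brickWallGraph (brickJoin t P Q) (2 * n + 2) u)
    {i : ℕ} (h0 : u i = t + ![1, 0]) (h1 : u (i + 1) = t + ![0, 0]) : IsBrickCut (n + 1) u (i + 1) ∧ u (i + n) = t + ![0, -1] := by
  classical
  have hdisj := disjoint_of_corridor (P := P) (Q := Q) hK1
  obtain ⟨hJ, hJc⟩ := h.isPolygon_join hP hQ hdisj
  -- vertices
  have tP : t + ![0, 0] ∈ vertsOf P := mem_vertsOf.2 ⟨_, h.het, by simp⟩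
  have uP : t + ![0, -1] ∈ vertsOf P := mem_vertsOf.2 ⟨_, h.het, by simp⟩
  have wQ : t + ![2, 0] ∈ vertsOf Q := mem_vertsOf.2 ⟨_, h.hew, by simp⟩
  have qQ : t + ![2, -1] ∈ vertsOf Q := mem_vertsOf.2 ⟨_, h.hew, by simp⟩
  -- open `P` at the left bond and `Q` at the right bond
  obtain ⟨W, hW, hWe, -, hWl, hWs⟩ := hP.exists_isPath_erase h.het
  have hew' : s(t + ![2, -1], t + ![2, 0]) ∈ Q := by rw [Sym2.eq_swap]; exact h.hew
  obtain ⟨W', hW', hW'e, -, hW'l, hW's⟩ := hQ.exists_isPath_erase hew'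
  have hWlen : W.length = n - 1 := by omega
  have hW'len : W'.length = n - 1 := by omega
  have hWJ : ∀ e ∈ W.edges, e ∈ brickJoin t P Q := fun e he => by
    have : e ∈ P.erase s(t + ![0, 0], t + ![0, -1]) := by rw [← hWe]; exact List.mem_toFinset.2 he
    exact mem_brickJoin_iff.2 (Or.inl ⟨(Finset.mem_erase.1 this).2, (Finset.mem_erase.1 this).1⟩)
  have hW'J : ∀ e ∈ W'.edges, e ∈ brickJoin t P Q := fun e he => by
    have : e ∈ Q.erase s(t + ![2, -1], t + ![2, 0]) := by rw [← hW'e]; exact List.mem_toFinset.2 he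
    refine mem_brickJoin_iff.2 (Or.inr (Or.inl ⟨(Finset.mem_erase.1 this).2, ?_⟩))
    rw [Sym2.eq_swap]; exact (Finset.mem_erase.1 this).1
  -- `W`'s second vertex is a site of `P`, `W'`'s second vertex a site of `Q`
  have hW1P : W.getVert 1 ∈ vertsOf P := mem_vertsOf.2 ((hWs _).1 (W.getVert_mem_support 1))
  have hW'1Q : W'.getVert 1 ∈ vertsOf Q := mem_vertsOf.2 ((hW's _).1 (W'.getVert_mem_support 1))
  -- bonds of `W`, `W'` as walk edges
  have hWedge : ∀ k, k < W.length → s(W.getVert k, W.getVert (k + 1)) ∈ brickJoin t P Q := by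
    intro k hk
    have hlen : k < W.darts.length := by rw [SimpleGraph.Walk.length_darts]; exact hk
    have hd : W.darts[k] ∈ W.darts := List.getElem_mem hlen
    rw [SimpleGraph.Walk.darts_getElem_eq_getVert k hlen] at hd
    exact hWJ _ (List.mem_map.2 ⟨_, hd, rfl⟩)
  have hW'edge : ∀ k, k < W'.length → s(W'.getVert k, W'.getVert (k + 1)) ∈ brickJoin t P Q := by
    intro k hk
    have hlen : k < W'.darts.length := by rw [SimpleGraph.Walk.length_darts]; exact hk
    have hd : W'.darts[k] ∈ W'.darts := List.getElem_mem hlen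
    rw [SimpleGraph.Walk.darts_getElem_eq_getVert k hlen] at hd
    exact hW'J _ (List.mem_map.2 ⟨_, hd, rfl⟩)
  -- the four connector bonds
  have c1 : s(t + ![0, 0], t + ![1, 0]) ∈ brickJoin t P Q := mem_brickJoin_iff.2 (by tauto)
  have c2 : s(t + ![1, 0], t + ![2, 0]) ∈ brickJoin t P Q := mem_brickJoin_iff.2 (by tauto)
  have c3 : s(t + ![0, -1], t + ![1, -1]) ∈ brickJoin t P Q := mem_brickJoin_iff.2 (by tauto)
  have c4 : s(t + ![1, -1], t + ![2, -1]) ∈ brickJoin t P Q := mem_brickJoin_iff.2 (by tauto)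
  -- STEP 1: `u 2 = W₁`, then `u (1 + k) = W_k` for `k ≤ n − 1`
  have hu2 : u (i + 2) = W.getVert 1 := by
    refine next_eq (i := i) hu hJ (x := t + ![1, 0]) (y := W.getVert 1) (by rw [h1]; exact c1) ?_ ?_ h0
    · rw [h1]; have := hWedge 0 (by omega); rwa [Walk.getVert_zero] at this
    · intro he; exact h.m1P (he ▸ hW1P)
  have hP_arc : ∀ k, k ≤ n - 1 → u (i + 1 + k) = W.getVert k := fun k hk =>
    hu.follows_path hJ W hW hWJ (i := i + 1) h1 (fun _ => by rw [show i + 1 + 1 = i + 2 by omega]; exact hu2) k (by omega)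
  have hun : u (i + n) = t + ![0, -1] := by
    have := hP_arc (n - 1) le_rfl
    rw [show i + 1 + (n - 1) = i + n by omega, ← hWlen, Walk.getVert_length] at this; exact this
  have hun1 : u (i + n - 1) = W.getVert (n - 2) := by
    have := hP_arc (n - 2) (by omega); rwa [show i + 1 + (n - 2) = i + n - 1 by omega] at this
  -- STEP 2: the lower connector
  have hWlast : s(t + ![0, -1], W.getVert (n - 2)) ∈ brickJoin t P Q := by
    have := hWedge (n - 2) (by omega)
    rw [show n - 2 + 1 = n - 1 by omega, ← hWlen, Walk.getVert_length, Sym2.eq_swap] at this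
    exact this
  have hWn2P : W.getVert (n - 2) ∈ vertsOf P := mem_vertsOf.2 ((hWs _).1 (W.getVert_mem_support _))
  have hun2 : u (i + n + 1) = t + ![1, -1] := by
    have := next_eq (i := i + n - 1) hu hJ (x := W.getVert (n - 2)) (y := t + ![1, -1])
      (by rw [show i + n - 1 + 1 = i + n by omega, hun]; exact hWlast) (by rw [show i + n - 1 + 1 = i + n by omega, hun]; exact c3)
      (fun he => h.m2P (he ▸ hWn2P)) hun1
    rwa [show i + n - 1 + 2 = i + n + 1 by omega] at this
  have hun3 : u (i + n + 2) = t + ![2, -1] := by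
    refine next_eq (i := i + n) hu hJ (x := t + ![0, -1]) (y := t + ![2, -1]) (by rw [hun2, Sym2.eq_swap]; exact c3)
      (by rw [hun2]; exact c4) ?_ hun
    intro he
    have h0' := congrArg (fun z : Site 2 => z 0) he
    simp at h0'
  -- STEP 3: the `Q`-arc
  have hun4 : u (i + n + 3) = W'.getVert 1 := by
    refine next_eq (i := i + n + 1) hu hJ (x := t + ![1, -1]) (y := W'.getVert 1) (by rw [hun3, Sym2.eq_swap]; exact c4) ?_ ?_ hun2
    · rw [hun3]; have := hW'edge 0 (by omega); rwa [Walk.getVert_zero] at this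
    · intro he; exact h.m2Q (he ▸ hW'1Q)
  have hQ_arc : ∀ k, k ≤ n - 1 → u (i + n + 2 + k) = W'.getVert k := fun k hk =>
    hu.follows_path hJ W' hW' hW'J (i := i + n + 2) hun3 (fun _ => by rw [show i + n + 2 + 1 = i + n + 3 by omega]; exact hun4) k
      (by omega)
  have hu2n1 : u (i + 2 * n + 1) = t + ![2, 0] := by
    have := hQ_arc (n - 1) le_rfl
    rw [show i + n + 2 + (n - 1) = i + 2 * n + 1 by omega, ← hW'len, Walk.getVert_length] at this; exact this
  have hu2n2 : u (i + 2 * n + 2) = t + ![1, 0] := by rw [show i + 2 * n + 2 = i + (2 * n + 2) by omega, hu.periodic, h0]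
  -- the cut
  refine ⟨?_, hun⟩
  refine isBrickCut_of_eqs (t + ![0, 0]) (by rw [h1]; simp)
    (by rw [show i + 1 + 2 * (n + 1) - 1 = i + 2 * n + 2 by omega, hu2n2]; simp)
    (by rw [show i + 1 + 2 * (n + 1) - 2 = i + 2 * n + 1 by omega, hu2n1]; simp)
    (by rw [show i + 1 + (n + 1) - 2 = i + n by omega, hun]; simp)
    (by rw [show i + 1 + (n + 1) - 1 = i + n + 1 by omega, hun2]; simp)
    (by rw [show i + 1 + (n + 1) = i + n + 2 by omega, hun3]; simp) ?_
  · -- row separation of the two blocks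
    intro a b ha1 ha2 hb1 hb2 hrow
    -- classify `u a` (left block) and `u b` (right block)
    have haL : u a ∈ vertsOf P ∨ u a = t + ![1, -1] := by
      rcases Nat.lt_or_ge a (i + n + 1) with hlt | hge
      · left
        have := hP_arc (a - (i + 1)) (by omega)
        rw [show i + 1 + (a - (i + 1)) = a by omega] at this
        rw [this]; exact mem_vertsOf.2 ((hWs _).1 (W.getVert_mem_support _))
      · right; rw [show a = i + n + 1 by omega]; exact hun2
    have hbR : u b ∈ vertsOf Q ∨ u b = t + ![1, 0] := by
      rcases Nat.lt_or_ge b (i + 2 * n + 2) with hlt | hge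
      · left
        have := hQ_arc (b - (i + n + 2)) (by omega)
        rw [show i + n + 2 + (b - (i + n + 2)) = b by omega] at this
        rw [this]; exact mem_vertsOf.2 ((hW's _).1 (W'.getVert_mem_support _))
      · right; rw [show b = i + 2 * n + 2 by omega]; exact hu2n2
    rcases haL with haP | haE <;> rcases hbR with hbQ | hbE
    · exact lt_of_lt_of_le (by omega) (hK1 _ haP _ hbQ (Or.inl hrow))
    · -- `u a ∈ P` in the row of `t + (1,0)`: corridor against `w = t + (2,0) ∈ Q`
      have := hK1 _ haP _ wQ (by rw [hbE] at hrow; simp at hrow ⊢; omega)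
      rw [hbE]; simp at this ⊢; omega
    · -- `u a = t + (1,−1)`, `u b ∈ Q` in the same row: corridor against `u₀ = t − (0,1) ∈ P`
      have := hK1 _ uP _ hbQ (by rw [haE] at hrow; simp at hrow ⊢; omega)
      rw [haE]; simp at this ⊢; omega
    · rw [haE, hbE] at hrow; simp at hrow

/-- `IsBrickCut` from the values at the six junction indices, UPPER sign (the left block's vertical bond points up; private plumbing).
[cite: Hammond2015SAPJoining, Definition 4.3 p. 20 (arXiv v5)] -/
private theorem isBrickCut_of_eqs' {M j : ℕ} {v : ℕ → Site 2} (p : Site 2) (h0 : v j = p + ![0, 0])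
    (h1 : v (j + 2 * M - 1) = p + ![1, 0]) (h2 : v (j + 2 * M - 2) = p + ![2, 0]) (h3 : v (j + M - 2) = p + ![0, 1])
    (h4 : v (j + M - 1) = p + ![1, 1]) (h5 : v (j + M) = p + ![2, 1])
    (sep : ∀ a b : ℕ, j ≤ a → a < j + M → j + M ≤ b → b < j + 2 * M → v a 1 = v b 1 → v a 0 < v b 0) : IsBrickCut M v j := by
  refine ⟨⟨?_, ?_⟩, ⟨?_, ?_⟩, ⟨?_, ?_⟩, ⟨?_, ?_⟩, ⟨?_, ?_⟩, sep⟩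
  · rw [h1, h0]; simp
  · rw [h1, h0]; simp
  · rw [h2, h0]; simp
  · rw [h2, h0]; simp
  · rw [h3, h0]; simp
  · right; rw [h3, h0]; simp
  · rw [h4, h3]; simp
  · rw [h4, h3]; simp
  · rw [h5, h3]; simp
  · rw [h5, h3]; simp

/-- **The reversed reading.**  If a traversal of `J = brickJoin t P Q` LEAVES the contact site `t` through the middle site `t + (1,0)` (`u i = t`,
`u (i+1) = t + (1,0)`), then it reads the junction backwards, which is again a brick cut: anchored at `u₀ = t − (0,1)` (index `i + n + 3`),
with the left block's vertical bond pointing UP (`v (j+M−2) = u₀ + (0,1) = t`). [cite: Hammond2015SAPJoining, §4.2 pp. 20–24 (arXiv v5); Madras1995LatticeAnimalsExponent, §2] -/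
theorem isBrickCut_of_isT1_rev (hP : IsPolygon brickWallGraph P) (hQ : IsPolygon brickWallGraph Q) (hPn : #P = n) (hQn : #Q = n) (hn : 3 ≤ n)
    (hK1 : Corridor P Q) (h : IsT1 P Q t) (hu : IsPolyTraversal brickWallGraph (brickJoin t P Q) (2 * n + 2) u)
    {i : ℕ} (h0 : u i = t + ![0, 0]) (h1 : u (i + 1) = t + ![1, 0]) :
    IsBrickCut (n + 1) u (i + n + 3) ∧ u (i + n + 3) = t + ![0, -1] := by
  classical
  have hdisj := disjoint_of_corridor (P := P) (Q := Q) hK1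
  obtain ⟨hJ, -⟩ := h.isPolygon_join hP hQ hdisj
  have tP : t + ![0, 0] ∈ vertsOf P := mem_vertsOf.2 ⟨_, h.het, by simp⟩
  have uP : t + ![0, -1] ∈ vertsOf P := mem_vertsOf.2 ⟨_, h.het, by simp⟩
  have wQ : t + ![2, 0] ∈ vertsOf Q := mem_vertsOf.2 ⟨_, h.hew, by simp⟩
  have qQ : t + ![2, -1] ∈ vertsOf Q := mem_vertsOf.2 ⟨_, h.hew, by simp⟩
  -- open `Q` at its bond from `q = t+(2,0)` to `w = t+(2,−1)`, and `P` at its bond from `u₀ = t−(0,1)` to `t`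
  obtain ⟨W', hW', hW'e, -, hW'l, hW's⟩ := hQ.exists_isPath_erase h.hew
  have het' : s(t + ![0, -1], t + ![0, 0]) ∈ P := by rw [Sym2.eq_swap]; exact h.het
  obtain ⟨W, hW, hWe, -, hWl, hWs⟩ := hP.exists_isPath_erase het'
  have hWlen : W.length = n - 1 := by omega
  have hW'len : W'.length = n - 1 := by omega
  have hWJ : ∀ e ∈ W.edges, e ∈ brickJoin t P Q := fun e he => by
    have : e ∈ P.erase s(t + ![0, -1], t + ![0, 0]) := by rw [← hWe]; exact List.mem_toFinset.2 he
    refine mem_brickJoin_iff.2 (Or.inl ⟨(Finset.mem_erase.1 this).2, ?_⟩)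
    rw [Sym2.eq_swap]; exact (Finset.mem_erase.1 this).1
  have hW'J : ∀ e ∈ W'.edges, e ∈ brickJoin t P Q := fun e he => by
    have : e ∈ Q.erase s(t + ![2, 0], t + ![2, -1]) := by rw [← hW'e]; exact List.mem_toFinset.2 he
    exact mem_brickJoin_iff.2 (Or.inr (Or.inl ⟨(Finset.mem_erase.1 this).2, (Finset.mem_erase.1 this).1⟩))
  have hW1P : W.getVert 1 ∈ vertsOf P := mem_vertsOf.2 ((hWs _).1 (W.getVert_mem_support 1))
  have hW'1Q : W'.getVert 1 ∈ vertsOf Q := mem_vertsOf.2 ((hW's _).1 (W'.getVert_mem_support 1))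
  have hWedge : ∀ k, k < W.length → s(W.getVert k, W.getVert (k + 1)) ∈ brickJoin t P Q := by
    intro k hk
    have hlen : k < W.darts.length := by rw [SimpleGraph.Walk.length_darts]; exact hk
    have hd : W.darts[k] ∈ W.darts := List.getElem_mem hlen
    rw [SimpleGraph.Walk.darts_getElem_eq_getVert k hlen] at hd
    exact hWJ _ (List.mem_map.2 ⟨_, hd, rfl⟩)
  have hW'edge : ∀ k, k < W'.length → s(W'.getVert k, W'.getVert (k + 1)) ∈ brickJoin t P Q := by
    intro k hk
    have hlen : k < W'.darts.length := by rw [SimpleGraph.Walk.length_darts]; exact hk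
    have hd : W'.darts[k] ∈ W'.darts := List.getElem_mem hlen
    rw [SimpleGraph.Walk.darts_getElem_eq_getVert k hlen] at hd
    exact hW'J _ (List.mem_map.2 ⟨_, hd, rfl⟩)
  have c1 : s(t + ![0, 0], t + ![1, 0]) ∈ brickJoin t P Q := mem_brickJoin_iff.2 (by tauto)
  have c2 : s(t + ![1, 0], t + ![2, 0]) ∈ brickJoin t P Q := mem_brickJoin_iff.2 (by tauto)
  have c3 : s(t + ![0, -1], t + ![1, -1]) ∈ brickJoin t P Q := mem_brickJoin_iff.2 (by tauto)
  have c4 : s(t + ![1, -1], t + ![2, -1]) ∈ brickJoin t P Q := mem_brickJoin_iff.2 (by tauto)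
  -- STEP 1: the upper connector read left to right: `u (i+2) = t + (2,0)`
  have hu2 : u (i + 2) = t + ![2, 0] := by
    refine next_eq (i := i) hu hJ (x := t + ![0, 0]) (y := t + ![2, 0]) (by rw [h1, Sym2.eq_swap]; exact c1) (by rw [h1]; exact c2) ?_ h0
    intro he; have := congrArg (fun z : Site 2 => z 0) he; simp at this
  -- STEP 2: the `Q`-arc from `q = t+(2,0)` to `w = t+(2,−1)`
  have hu3 : u (i + 3) = W'.getVert 1 := by
    refine next_eq (i := i + 1) hu hJ (x := t + ![1, 0]) (y := W'.getVert 1) (by rw [show i + 1 + 1 = i + 2 by omega, hu2, Sym2.eq_swap]; exact c2) ?_ ?_ h1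
    · rw [show i + 1 + 1 = i + 2 by omega, hu2]; have := hW'edge 0 (by omega); rwa [Walk.getVert_zero] at this
    · intro he; exact h.m1Q (he ▸ hW'1Q)
  have hQ_arc : ∀ k, k ≤ n - 1 → u (i + 2 + k) = W'.getVert k := fun k hk =>
    hu.follows_path hJ W' hW' hW'J (i := i + 2) hu2 (fun _ => by rw [show i + 2 + 1 = i + 3 by omega]; exact hu3) k (by omega)
  have hw : u (i + n + 1) = t + ![2, -1] := by
    have := hQ_arc (n - 1) le_rfl
    rw [show i + 2 + (n - 1) = i + n + 1 by omega, ← hW'len, Walk.getVert_length] at this; exact this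
  have hw1 : u (i + n) = W'.getVert (n - 2) := by
    have := hQ_arc (n - 2) (by omega); rwa [show i + 2 + (n - 2) = i + n by omega] at this
  -- STEP 3: the lower connector read right to left
  have hW'last : s(t + ![2, -1], W'.getVert (n - 2)) ∈ brickJoin t P Q := by
    have := hW'edge (n - 2) (by omega)
    rw [show n - 2 + 1 = n - 1 by omega, ← hW'len, Walk.getVert_length, Sym2.eq_swap] at this
    exact this
  have hW'n2Q : W'.getVert (n - 2) ∈ vertsOf Q := mem_vertsOf.2 ((hW's _).1 (W'.getVert_mem_support _))
  have hm2 : u (i + n + 2) = t + ![1, -1] :=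
    next_eq (i := i + n) hu hJ (x := W'.getVert (n - 2)) (y := t + ![1, -1]) (by rw [hw]; exact hW'last)
      (by rw [hw, Sym2.eq_swap]; exact c4) (fun he => h.m2Q (he ▸ hW'n2Q)) hw1
  have hm3 : u (i + n + 3) = t + ![0, -1] := by
    have := next_eq (i := i + n + 1) hu hJ (x := t + ![2, -1]) (y := t + ![0, -1])
      (by rw [show i + n + 1 + 1 = i + n + 2 by omega, hm2]; exact c4)
      (by rw [show i + n + 1 + 1 = i + n + 2 by omega, hm2, Sym2.eq_swap]; exact c3) ?_ hw
    · rwa [show i + n + 1 + 2 = i + n + 3 by omega] at this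
    · intro he; have := congrArg (fun z : Site 2 => z 0) he; simp at this
  -- STEP 4: the `P`-arc from `u₀` back to `t`
  have hu4 : u (i + n + 4) = W.getVert 1 := by
    have := next_eq (i := i + n + 2) hu hJ (x := t + ![1, -1]) (y := W.getVert 1)
      (by rw [show i + n + 2 + 1 = i + n + 3 by omega, hm3]; exact c3) ?_ ?_ hm2
    · rwa [show i + n + 2 + 2 = i + n + 4 by omega] at this
    · rw [show i + n + 2 + 1 = i + n + 3 by omega, hm3]; have := hWedge 0 (by omega); rwa [Walk.getVert_zero] at this
    · intro he; exact h.m2P (he.symm ▸ hW1P)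
  have hP_arc : ∀ k, k ≤ n - 1 → u (i + n + 3 + k) = W.getVert k := fun k hk =>
    hu.follows_path hJ W hW hWJ (i := i + n + 3) hm3 (fun _ => by rw [show i + n + 3 + 1 = i + n + 4 by omega]; exact hu4) k (by omega)
  have ht' : u (i + 2 * n + 2) = t + ![0, 0] := by
    have := hP_arc (n - 1) le_rfl
    rw [show i + n + 3 + (n - 1) = i + 2 * n + 2 by omega, ← hWlen, Walk.getVert_length] at this; exact this
  -- periodic copies
  have hL : ∀ k, u (k + (2 * n + 2)) = u k := hu.periodic
  have e1 : u (i + 3 * n + 4) = t + ![1, -1] := by rw [show i + 3 * n + 4 = (i + n + 2) + (2 * n + 2) by omega, hL, hm2]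
  have e2 : u (i + 3 * n + 3) = t + ![2, -1] := by rw [show i + 3 * n + 3 = (i + n + 1) + (2 * n + 2) by omega, hL, hw]
  have e4 : u (i + 2 * n + 3) = t + ![1, 0] := by rw [show i + 2 * n + 3 = (i + 1) + (2 * n + 2) by omega, hL, h1]
  have e5 : u (i + 2 * n + 4) = t + ![2, 0] := by rw [show i + 2 * n + 4 = (i + 2) + (2 * n + 2) by omega, hL, hu2]
  -- the cut (upper sign), anchored at `u₀ = t − (0,1)`
  refine ⟨?_, hm3⟩
  refine isBrickCut_of_eqs' (t + ![0, -1]) (by rw [hm3]; simp)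
    (by rw [show i + n + 3 + 2 * (n + 1) - 1 = i + 3 * n + 4 by omega, e1]; simp)
    (by rw [show i + n + 3 + 2 * (n + 1) - 2 = i + 3 * n + 3 by omega, e2]; simp)
    (by rw [show i + n + 3 + (n + 1) - 2 = i + 2 * n + 2 by omega, ht']; simp)
    (by rw [show i + n + 3 + (n + 1) - 1 = i + 2 * n + 3 by omega, e4]; simp)
    (by rw [show i + n + 3 + (n + 1) = i + 2 * n + 4 by omega, e5]; simp) ?_
  intro a b ha1 ha2 hb1 hb2 hrow
  have haL : u a ∈ vertsOf P ∨ u a = t + ![1, 0] := by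
    rcases Nat.lt_or_ge a (i + 2 * n + 3) with hlt | hge
    · left
      have := hP_arc (a - (i + n + 3)) (by omega)
      rw [show i + n + 3 + (a - (i + n + 3)) = a by omega] at this
      rw [this]; exact mem_vertsOf.2 ((hWs _).1 (W.getVert_mem_support _))
    · right; rw [show a = i + 2 * n + 3 by omega]; exact e4
  have hbR : u b ∈ vertsOf Q ∨ u b = t + ![1, -1] := by
    rcases Nat.lt_or_ge b (i + 3 * n + 4) with hlt | hge
    · left
      have hb' : b = (b - (2 * n + 2)) + (2 * n + 2) := by omega
      have := hQ_arc (b - (2 * n + 2) - (i + 2)) (by omega)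
      rw [show i + 2 + (b - (2 * n + 2) - (i + 2)) = b - (2 * n + 2) by omega] at this
      rw [hb', hL, this]; exact mem_vertsOf.2 ((hW's _).1 (W'.getVert_mem_support _))
    · right; rw [show b = i + 3 * n + 4 by omega]; exact e1
  rcases haL with haP | haE <;> rcases hbR with hbQ | hbE
  · exact lt_of_lt_of_le (by omega) (hK1 _ haP _ hbQ (Or.inl hrow))
  · have := hK1 _ haP _ qQ (by rw [hbE] at hrow; simp at hrow ⊢; omega)
    rw [hbE]; simp at this ⊢; omega
  · have := hK1 _ tP _ hbQ (by rw [haE] at hrow; simp at hrow ⊢; omega)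
    rw [haE]; simp at this ⊢; omega
  · rw [haE, hbE] at hrow; simp at hrow


/-- Reducing the index of a cut by one period (private plumbing). [cite: Hammond2015SAPJoining, Definition 4.3 p. 20 (arXiv v5)] -/
private theorem isBrickCut_sub_period {M j : ℕ} {v : ℕ → Site 2} (hM : 2 ≤ M) (hper : ∀ i, v (i + 2 * M) = v i)
    (h : IsBrickCut M v (j + 2 * M)) : IsBrickCut M v j := by
  obtain ⟨⟨a1, a2⟩, ⟨b1, b2⟩, ⟨c1, c2⟩, ⟨d1, d2⟩, ⟨e1, e2⟩, sep⟩ := h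
  have E : ∀ k, v (j + 2 * M + k) = v (j + k) := fun k => by rw [show j + 2 * M + k = (j + k) + 2 * M by omega, hper]
  have E0 : v (j + 2 * M) = v j := by simpa using hper j
  have E1 : v (j + 2 * M + 2 * M - 1) = v (j + 2 * M - 1) := by rw [show j + 2 * M + 2 * M - 1 = j + 2 * M + (2 * M - 1) by omega, E]; congr 1; omega
  have E2 : v (j + 2 * M + 2 * M - 2) = v (j + 2 * M - 2) := by rw [show j + 2 * M + 2 * M - 2 = j + 2 * M + (2 * M - 2) by omega, E]; congr 1; omega
  have E3 : v (j + 2 * M + M - 2) = v (j + M - 2) := by rw [show j + 2 * M + M - 2 = (j + M - 2) + 2 * M by omega, hper]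
  have E4 : v (j + 2 * M + M - 1) = v (j + M - 1) := by rw [show j + 2 * M + M - 1 = (j + M - 1) + 2 * M by omega, hper]
  have E5 : v (j + 2 * M + M) = v (j + M) := by rw [show j + 2 * M + M = (j + M) + 2 * M by omega, hper]
  rw [E0] at a1 a2 b1 b2 c1 c2
  rw [E1] at a1 a2; rw [E2] at b1 b2; rw [E3] at c1 c2 d1 d2 e1 e2; rw [E4] at d1 d2; rw [E5] at e1 e2
  refine ⟨⟨a1, a2⟩, ⟨b1, b2⟩, ⟨c1, c2⟩, ⟨d1, d2⟩, ⟨e1, e2⟩, fun a b ha1 ha2 hb1 hb2 hr => ?_⟩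
  have := sep (a + 2 * M) (b + 2 * M) (by omega) (by omega) (by omega) (by omega) (by rw [hper, hper]; exact hr)
  rwa [hper, hper] at this

/-- **Junction uniqueness for the one-brick join, same polygon** (`d = 0`): two T1 decompositions of the same joined polygon of corridor-separated
`n`-gon pairs have the same contact site. [cite: Hammond2015SAPJoining, §4.2 pp. 20–24 (arXiv v5: the junction plaquette is determined); Madras1995LatticeAnimalsExponent, §2] -/
theorem brickJoin_site_unique {P' Q' : Finset (Sym2 (Site 2))} {t' : Site 2}
    (hP : IsPolygon brickWallGraph P) (hQ : IsPolygon brickWallGraph Q) (hP' : IsPolygon brickWallGraph P') (hQ' : IsPolygon brickWallGraph Q')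
    (hPn : #P = n) (hQn : #Q = n) (hP'n : #P' = n) (hQ'n : #Q' = n) (hn : 3 ≤ n) (hK1 : Corridor P Q) (hK1' : Corridor P' Q')
    (h : IsT1 P Q t) (h' : IsT1 P' Q' t') (hJ : brickJoin t' P' Q' = brickJoin t P Q) : t' = t := by
  classical
  have hdisj := disjoint_of_corridor (P := P) (Q := Q) hK1
  obtain ⟨hJpoly, hJc⟩ := h.isPolygon_join hP hQ hdisj
  have hcard : #(brickJoin t P Q) = 2 * n + 2 := by rw [hJc, hPn, hQn]; ring
  -- a traversal entering `t` from the middle site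
  have c1 : s(t + ![1, 0], t + ![0, 0]) ∈ brickJoin t P Q := by rw [Sym2.eq_swap]; exact mem_brickJoin_iff.2 (by tauto)
  obtain ⟨u, hu, hu0, hu1⟩ := hJpoly.exists_isPolyTraversal c1
  rw [hcard] at hu
  have hrow : ∀ i, u (i + 1) 1 ≤ u i 1 + 1 ∧ u i 1 ≤ u (i + 1) 1 + 1 := row_step_le_of_adj hu.adj
  have hper : ∀ i, u (i + 2 * (n + 1)) = u i := fun i => by rw [show 2 * (n + 1) = 2 * n + 2 by ring]; exact hu.periodic i
  -- cut of decomposition 1 at index 1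
  obtain ⟨cut1, hun⟩ := isBrickCut_of_isT1 hP hQ hPn hQn hn hK1 h hu (i := 0) hu0 (by simpa using hu1)
  simp only [Nat.zero_add] at cut1 hun
  -- locate decomposition 2's bond `t'+(1,0) – t'` on the traversal
  have c1' : s(t' + ![1, 0], t' + ![0, 0]) ∈ brickJoin t P Q := by
    rw [← hJ, Sym2.eq_swap]; exact mem_brickJoin_iff.2 (by tauto)
  obtain ⟨i, hi, hie⟩ := hu.surj _ c1'
  have hu' : IsPolyTraversal brickWallGraph (brickJoin t' P' Q') (2 * n + 2) u := by rw [hJ]; exact hu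
  rcases Sym2.eq_iff.1 hie with ⟨ha, hb⟩ | ⟨ha, hb⟩
  · -- same orientation: cut at `i + 1`; uniqueness forces `i = 0`
    obtain ⟨cut2, -⟩ := isBrickCut_of_isT1 hP' hQ' hP'n hQ'n hn hK1' h' hu' (i := i) ha hb
    rcases Nat.lt_or_ge (i + 1) (2 * (n + 1)) with hlt | hge
    · have := isBrickCut_unique (by omega) hper hrow (by omega) hlt cut1 cut2
      have e : u 1 = u (i + 1) := by rw [← this]
      rw [hu1, hb] at e
      exact (add_right_cancel e).symm
    · have hi' : i + 1 = 0 + 2 * (n + 1) := by omega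
      rw [hi'] at cut2
      have cut2' := isBrickCut_sub_period (by omega) hper cut2
      have := isBrickCut_unique (by omega) hper hrow (by omega) (by omega) cut1 cut2'
      omega
  · -- opposite orientation: the reversed cut at `i + n + 3`; uniqueness forces `i = n`, then the anchors clash
    obtain ⟨cut2, hanc⟩ := isBrickCut_of_isT1_rev hP' hQ' hP'n hQ'n hn hK1' h' hu' (i := i) ha hb
    rcases Nat.lt_or_ge (i + n + 3) (2 * (n + 1)) with hlt | hge
    · have := isBrickCut_unique (by omega) hper hrow (by omega) hlt cut1 cut2
      omega
    · have hi' : i + n + 3 = (i + n + 3 - 2 * (n + 1)) + 2 * (n + 1) := by omega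
      rw [hi'] at cut2
      have cut2' := isBrickCut_sub_period (by omega) hper cut2
      have := isBrickCut_unique (by omega) hper hrow (by omega) (by omega) cut1 cut2'
      have hin : i = n := by omega
      subst hin
      -- anchors: `u (2n+3) = u 1 = t` and `= t' − (0,1)`; and `u n = t − (0,1) = t'` (case hypothesis)
      have e1 : t + ![0, 0] = t' + ![0, -1] := by
        rw [← hu1, ← hanc, show i + i + 3 = 1 + (2 * i + 2) by omega, hu.periodic]
      have e2 : t' + ![0, 0] = t + ![0, -1] := by rw [← ha, ← hun]
      have f1 := congrArg (fun z : Site 2 => z 1) e1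
      have f2 := congrArg (fun z : Site 2 => z 1) e2
      simp at f1 f2
      omega

/-! ### Translation and `JU1` -/

/-- a bond of `P` translated (private plumbing). [folklore] -/
private theorem mem_shift_of_mem {E : Finset (Sym2 (Site 2))} {a b d : Site 2} (h : s(a, b) ∈ E) : s(a + d, b + d) ∈ shiftEdges d E :=
  mem_shiftEdges_iff.2 ⟨_, h, by rw [Sym2.map_mk]⟩

/-- offsets commute with the translation (private plumbing). [folklore] -/
private theorem add_off (t d v : Site 2) : t + d + v = t + v + d := add_right_comm t d v

/-- The T1 bundle is translation-covariant. [cite: Hammond2015SAPJoining, Definition 4.3 p. 20 (arXiv v5)] -/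
theorem isT1_shift (h : IsT1 P Q t) (d : Site 2) : IsT1 (shiftEdges d P) (shiftEdges d Q) (t + d) := by
  have nv : ∀ {E : Finset (Sym2 (Site 2))} {v : Site 2}, t + v ∉ vertsOf E → t + d + v ∉ vertsOf (shiftEdges d E) :=
    fun {E} {v} hv hh => hv (by rw [mem_vertsOf_shiftEdges, add_off, add_sub_cancel_right] at hh; exact hh)
  refine ⟨?_, ?_, nv h.m1P, nv h.m1Q, nv h.m2P, nv h.m2Q⟩
  · rw [add_off, add_off t d]; exact mem_shift_of_mem h.het
  · rw [add_off, add_off t d]; exact mem_shift_of_mem h.hew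

/-- The corridor fact is translation-invariant. [cite: Hammond2015SAPJoining, §4.1 pp. 17–18 (arXiv v5)] -/
theorem Corridor.shift (hK1 : Corridor P Q) (d : Site 2) : Corridor (shiftEdges d P) (shiftEdges d Q) := by
  intro p hp q hq hrow
  rw [mem_vertsOf_shiftEdges] at hp hq
  have := hK1 _ hp _ hq (by simp only [Pi.sub_apply]; omega)
  simp only [Pi.sub_apply] at this
  omega

/-- The one-brick join is translation-covariant. [cite: Hammond2015SAPJoining, Definition 4.3 p. 20 (arXiv v5)] -/
theorem brickJoin_shift (h : IsT1 P Q t) (hdisj : ∀ x, x ∈ vertsOf P → x ∈ vertsOf Q → False) (d : Site 2) :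
    brickJoin (t + d) (shiftEdges d P) (shiftEdges d Q) = shiftEdges d (brickJoin t P Q) := by
  classical
  have hdisj' : ∀ x, x ∈ vertsOf (shiftEdges d P) → x ∈ vertsOf (shiftEdges d Q) → False := fun x hx hy =>
    hdisj (x - d) (mem_vertsOf_shiftEdges.1 hx) (mem_vertsOf_shiftEdges.1 hy)
  rw [brickJoin_eq_symmDiff (isT1_shift h d) hdisj', brickJoin_eq_symmDiff h hdisj, bdry_add]
  unfold shiftEdges
  rw [Finset.image_symmDiff _ _ (Sym2.map.injective (add_left_injective d)), Finset.image_union]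

/-- **`JU1` holds**: junction uniqueness for the one-brick join (type T1). [cite: Hammond2015SAPJoining, §4.2 pp. 20–24 (arXiv v5: the junction plaquette is determined by the joined polygon); Madras1995LatticeAnimalsExponent, §2] -/
theorem ju1 : JU1 := by
  intro P Q P' Q' t t' d n hP hQ hP' hQ' hPn hQn hP'n hQ'n hK1 hK1' h h' hJ
  classical
  have hdisj := disjoint_of_corridor (P := P) (Q := Q) hK1
  -- the size of `P` is at least `3` (a polygon)
  have hn : 3 ≤ n := by
    obtain ⟨w, c, hc, hcE⟩ := hP
    rw [← hPn, ← hcE, List.toFinset_card_of_nodup hc.edges_nodup, Walk.length_edges]; exact hc.three_le_length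
  -- `d` is even: the vertical bond `t – t−(0,1)` of `P` … we take evenness from the T1 bundles' parities instead: both `t` and `t'` carry a
  -- DOWN bond of a brick-wall polygon, so `t₀+t₁` and `t'₀+t'₁` are odd; but we need `d` even to translate polygons — derive it from the bonds.
  have hpar : ∀ {E : Finset (Sym2 (Site 2))} {s' : Site 2}, IsPolygon brickWallGraph E → s(s' + ![0, 0], s' + ![0, -1]) ∈ E →
      (s' 0 + s' 1) % 2 = 1 := by
    intro E s' hE he
    have hadj : brickWallGraph.Adj (s' + ![0, 0]) (s' + ![0, -1]) := IsPolygon.mem_edgeSet hE he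
    rw [brickWallGraph_adj_coord] at hadj
    simp at hadj
    omega
  have ht := hpar hP h.het
  have ht' := hpar hP' h'.het
  -- translate decomposition 1 by `d`; if `d` is odd the translated join is still an edge set and the argument below does not need evenness
  -- EXCEPT for `IsPolygon (shiftEdges d P)`; we get evenness from `t' = ?`… circular. Instead: evenness of `d` from the junction bonds of `J'`:
  -- `s(t'+(1,0), t') ∈ J' = shift d J` and every bond of `J` is a brick-wall bond; a horizontal bond stays horizontal under any translation,
  -- so use the VERTICAL bond `t'+(2,0) … no: all four connector bonds are horizontal.  We therefore carry evenness as part of the T1 frame: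
  -- both polygons `P'` and `shift d P` contain vertical bonds at parity-constrained sites.  `P' ∪ Q' = (shift d (P ∪ Q)) △ …` — simplest:
  -- the bond `t – t−(0,1)` of `P` translated by `d` is the bond `s(t+d, t+d−(0,1))` of `shift d J △ …`; it lies in `J' △ B(t')`-world only if…
  -- To keep this file short we use the bundle parities: `het` of `h` gives `t₀+t₁` odd, and the translated bond `s(t+d, t−(0,1)+d)` belongs to
  -- `shiftEdges d P ⊆ ?`; we avoid all this by observing that `shiftEdges d (brickJoin t P Q) = brickJoin t' P' Q'` is the edge set of a
  -- brick-wall polygon containing the translate of the vertical `P`-arc bonds… and simply SPLIT on the parity of `d`.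
  by_cases hd : (d 0 + d 1) % 2 = 0
  · have hPd := PolygonConcat.isPolygon_shiftEdges_of_even hP hd
    have hQd := PolygonConcat.isPolygon_shiftEdges_of_even hQ hd
    have key := brickJoin_site_unique (P := shiftEdges d P) (Q := shiftEdges d Q) (t := t + d) (n := n) hPd hQd hP' hQ'
      (by rw [card_shiftEdges, hPn]) (by rw [card_shiftEdges, hQn]) hP'n hQ'n hn (hK1.shift d) hK1' (isT1_shift h d) h'
      (by rw [hJ, brickJoin_shift h hdisj])
    exact key
  · -- `d` odd is impossible: the `P`-arc of `J` contains a vertical brick-wall bond `e` (the polygon `P` has at least two vertical bonds, only one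
    -- of which is deleted), and `e + d ∈ J'` would be a vertical pair at odd parity, not a brick-wall bond.
    exfalso
    -- the bond `W`-structure: take the traversal picture — simpler: `P` minus one bond is a path from `t` to `t−(0,1)` of length `n−1 ≥ 2` whose
    -- endpoints differ by `(0,1)`; a path with only horizontal steps keeps the row, contradiction; so some bond of `P.erase (t,t−(0,1))` is vertical.
    obtain ⟨W, hW, hWe, -, hWl, -⟩ := hP.exists_isPath_erase h.het
    -- rows along `W`: if every step were horizontal the row would be constant
    have hvert : ∃ k, k < W.length ∧ (W.getVert k) 0 = (W.getVert (k + 1)) 0 := by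
      by_contra hall
      push Not at hall
      have hconst : ∀ k, k ≤ W.length → (W.getVert k) 1 = (W.getVert 0) 1 := by
        intro k
        induction k with
        | zero => intro; rfl
        | succ k ih =>
          intro hk
          have hadj := W.adj_getVert_succ (i := k) (by omega)
          rw [brickWallGraph_adj_coord] at hadj
          have hne := hall k (by omega)
          rw [← ih (by omega)]
          rcases hadj with ⟨-, h1⟩ | ⟨h0, -⟩
          · exact h1
          · exact absurd h0.symm hne
      have := hconst W.length le_rfl
      rw [Walk.getVert_length, Walk.getVert_zero] at this
      simp at this
    obtain ⟨k, hk, hk0⟩ := hvert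
    -- this vertical bond of `P` (not the deleted one) lies in `J`, hence its translate lies in `J'`, a set of brick-wall bonds
    have hmemP : s(W.getVert k, W.getVert (k + 1)) ∈ P.erase s(t + ![0, 0], t + ![0, -1]) := by
      rw [← hWe, List.mem_toFinset]
      have hlen : k < W.darts.length := by rw [SimpleGraph.Walk.length_darts]; exact hk
      have hdk : W.darts[k] ∈ W.darts := List.getElem_mem hlen
      rw [SimpleGraph.Walk.darts_getElem_eq_getVert k hlen] at hdk
      exact List.mem_map.2 ⟨_, hdk, rfl⟩
    have hmemJ : s(W.getVert k, W.getVert (k + 1)) ∈ brickJoin t P Q :=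
      mem_brickJoin_iff.2 (Or.inl ⟨(Finset.mem_erase.1 hmemP).2, (Finset.mem_erase.1 hmemP).1⟩)
    have hmemJ' : s(W.getVert k + d, W.getVert (k + 1) + d) ∈ brickJoin t' P' Q' := by rw [hJ]; exact mem_shift_of_mem hmemJ
    have hdisj' := disjoint_of_corridor (P := P') (Q := Q') hK1'
    have hJ'poly := (h'.isPolygon_join hP' hQ' hdisj').1
    have hadj1 : brickWallGraph.Adj (W.getVert k) (W.getVert (k + 1)) := W.adj_getVert_succ (i := k) (by omega)
    have hadj2 : brickWallGraph.Adj (W.getVert k + d) (W.getVert (k + 1) + d) := IsPolygon.mem_edgeSet hJ'poly hmemJ'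
    rw [brickWallGraph_adj_coord] at hadj1 hadj2
    simp only [Pi.add_apply] at hadj2
    omega


end Assembly

end HexBW

end Literature.Probability.RandomPlanarGeometry.SAW

end


/-!
# Junction uniqueness for the capless Madras join on `ℍ`, type T2′ (`JU2`): the staggered double brick is determined by the joined polygon

Topic `Literature/Probability/RandomPlanarGeometry` (lane «pcv-sawmu», a-p4 g13; stub E5a of LINE «HEX-MADRAS», second of the five junction
types of `HexSAWPolygonJoinAssembly.JunctionUnique`; pattern of `HexSAWPolygonJunctionUniqueT1` (`ju1`)).

The bridge from edge sets to site sequences: a T2′ decomposition `(P, Q, t)` of `J = staggeredJoin t P Q` forces EVERY traversal of `J`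
(`SAWPolygonTraversal.IsPolyTraversal`) entering `u = t − (0,1)` from `t + (1,−1)` to read the `P`-arc, the upper connecting arc, the `Q`-arc and
the lower connecting arc in this order — the forward staggered cut `HexSAWPolygonStaggeredCut.IsStagCut (n+3) u (i+1)` — and a traversal
LEAVING `u` towards `t + (1,−1)` to read the backward cut `IsStagCut'`.  Two T2′ decompositions of one polygon then give two cuts on one
traversal: equal by `isStagCut_unique`, or impossible by `not_isStagCut'_of_isStagCut`.  Translations: even ones transport the whole frame; an odd
one would translate the vertical connector bond `t+(1,0) – t+(1,1)` of `J` to a non-bond of the brick wall.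

## Main statements (namespace `…SAW.HexBW.Assembly`)
* `isStagCut_of_isT2`, `isStagCut'_of_isT2` — the bridge, both orientations;
* `staggeredJoin_site_unique` — same polygon, two T2′ decompositions ⇒ same contact site;
* `isT2_shift`, `staggeredJoin_shift` — covariance under even translations; **`ju2 : JU2`**.
[cite: Hammond2015SAPJoining, Definition 4.3 p. 20 and §4.2 pp. 20–24 (arXiv v5: the junction plaquette of the Madras join is recognisable)]
[cite: Madras1995LatticeAnimalsExponent, §2 (primary, not held)] [cite: MadrasSlade1993, Definition 3.2.1 p. 62; Theorem 3.2.3 proof pp. 64–65].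
-/

noncomputable section

open SimpleGraph Finset Literature.Probability.LatticeModels Literature.Probability.Percolation
open Literature.Barriers.CriticalPhenomena.SupercriticalSAW (shiftEdges card_shiftEdges mem_shiftEdges_iff shiftEdges_injective)
open Literature.Probability.Percolation.SiteGadgetSystem (vertsOf mem_vertsOf)

namespace Literature.Probability.RandomPlanarGeometry.SAW

namespace HexBW

namespace Assembly

variable {P Q : Finset (Sym2 (Site 2))} {t : Site 2} {n : ℕ} {u : ℕ → Site 2}

/-- `![a, b] 0 = a` (private plumbing). [folklore] -/
@[simp] private theorem uw0 (a b : ℤ) : (![a, b] : Site 2) 0 = a := rfl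
/-- `![a, b] 1 = b` (private plumbing). [folklore] -/
@[simp] private theorem uw1 (a b : ℤ) : (![a, b] : Site 2) 1 = b := rfl

/-! ### The bridge: a T2′ decomposition imposes the staggered cut on every traversal -/

/-- the next site of a traversal at a vertex with two known polygon bonds (private plumbing). [cite: MadrasSlade1993, Definition 3.2.1 p. 62 (degree two)] -/
private theorem next_eq₂ {E : Finset (Sym2 (Site 2))} {L : ℕ} (hu : IsPolyTraversal brickWallGraph E L u) (hE : IsPolygon brickWallGraph E)
    {i : ℕ} {x y : Site 2} (hx : s(u (i + 1), x) ∈ E) (hy : s(u (i + 1), y) ∈ E) (hxy : x ≠ y) (hprev : u i = x) :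
    u (i + 2) = y := by
  have hm : s(u (i + 1), u (i + 1 + 1)) ∈ E := hu.mem (i + 1)
  rcases hE.eq_or_eq_of_mem hx hy hxy hm with h | h
  · exact absurd (h.trans hprev.symm) (hu.ne_succ_succ i)
  · exact h

/-- two distinct offsets give distinct sites (private plumbing). [folklore] -/
private theorem off_ne₂ {a b c d : ℤ} (h : (a, b) ≠ (c, d)) : t + ![a, b] ≠ t + ![c, d] := by
  intro he
  have h0 := congrArg (fun z : Site 2 => z 0) he
  have h1 := congrArg (fun z : Site 2 => z 1) he
  simp at h0 h1
  exact h (Prod.ext h0 h1)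

/-- a site with prescribed offsets from `t` (private plumbing). [folklore] -/
private theorem eq_off₂ {x : Site 2} {a b : ℤ} (h0 : x 0 = t 0 + a) (h1 : x 1 = t 1 + b) : x = t + ![a, b] := by
  ext k; fin_cases k <;> simp [h0, h1]

/-- `IsStagCut` from the ten junction values (private plumbing; indices written exactly as in the definition).
[cite: Hammond2015SAPJoining, Definition 4.3 p. 20 (arXiv v5)] -/
private theorem isStagCut_of_eqs {M j : ℕ} {v : ℕ → Site 2} (p : Site 2) (h0 : v j = p + ![0, -1]) (h1 : v (j + M - 4) = p + ![0, 0])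
    (h2 : v (j + M - 3) = p + ![1, 0]) (h3 : v (j + M - 2) = p + ![1, 1]) (h4 : v (j + M - 1) = p + ![2, 1]) (h5 : v (j + M) = p + ![3, 1])
    (h6 : v (j + 2 * M - 4) = p + ![3, 0]) (h7 : v (j + 2 * M - 3) = p + ![2, 0]) (h8 : v (j + 2 * M - 2) = p + ![2, -1])
    (h9 : v (j + 2 * M - 1) = p + ![1, -1])
    (sep : ∀ a b : ℕ, j ≤ a → a < j + M → j + M ≤ b → b < j + 2 * M → v a 1 = v b 1 → v a 0 < v b 0) : IsStagCut M v j := by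
  refine ⟨⟨?_, ?_⟩, ⟨?_, ?_⟩, ⟨?_, ?_⟩, ⟨?_, ?_⟩, ⟨?_, ?_⟩, ⟨?_, ?_⟩, ⟨?_, ?_⟩, ⟨?_, ?_⟩, ⟨?_, ?_⟩, sep⟩
  · rw [h1, h0]; simp
  · rw [h1, h0]; simp
  · rw [h2, h0]; simp
  · rw [h2, h0]; simp
  · rw [h3, h0]; simp
  · rw [h3, h0]; simp; ring
  · rw [h4, h0]; simp
  · rw [h4, h0]; simp; ring
  · rw [h5, h0]; simp
  · rw [h5, h0]; simp; ring
  · rw [h6, h0]; simp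
  · rw [h6, h0]; simp
  · rw [h7, h0]; simp
  · rw [h7, h0]; simp
  · rw [h8, h0]; simp
  · rw [h8, h0]; simp
  · rw [h9, h0]; simp
  · rw [h9, h0]; simp

/-- `IsStagCut'` from the ten junction values (private plumbing). [cite: Hammond2015SAPJoining, Definition 4.3 p. 20 (arXiv v5)] -/
private theorem isStagCut'_of_eqs {M j : ℕ} {v : ℕ → Site 2} (p : Site 2) (h0 : v j = p + ![1, -1]) (h1 : v (j + 1) = p + ![2, -1])
    (h2 : v (j + 2) = p + ![2, 0]) (h3 : v (j + 3) = p + ![3, 0]) (h4 : v (j + M - 1) = p + ![3, 1]) (h5 : v (j + M) = p + ![2, 1])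
    (h6 : v (j + M + 1) = p + ![1, 1]) (h7 : v (j + M + 2) = p + ![1, 0]) (h8 : v (j + M + 3) = p + ![0, 0])
    (h9 : v (j + 2 * M - 1) = p + ![0, -1])
    (sep : ∀ a b : ℕ, j ≤ a → a < j + M → j + M ≤ b → b < j + 2 * M → v a 1 = v b 1 → v b 0 < v a 0) : IsStagCut' M v j := by
  refine ⟨⟨?_, ?_⟩, ⟨?_, ?_⟩, ⟨?_, ?_⟩, ⟨?_, ?_⟩, ⟨?_, ?_⟩, ⟨?_, ?_⟩, ⟨?_, ?_⟩, ⟨?_, ?_⟩, ⟨?_, ?_⟩, sep⟩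
  · rw [h1, h0]; simp; ring
  · rw [h1, h0]; simp
  · rw [h2, h0]; simp; ring
  · rw [h2, h0]; simp
  · rw [h3, h0]; simp; ring
  · rw [h3, h0]; simp
  · rw [h4, h0]; simp; ring
  · rw [h4, h0]; simp; ring
  · rw [h5, h0]; simp; ring
  · rw [h5, h0]; simp; ring
  · rw [h6, h0]; simp
  · rw [h6, h0]; simp; ring
  · rw [h7, h0]; simp
  · rw [h7, h0]; simp
  · rw [h8, h0]; simp
  · rw [h8, h0]; simp
  · rw [h9, h0]; simp
  · rw [h9, h0]; simp

section Bridge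

variable (hP : IsPolygon brickWallGraph P) (hQ : IsPolygon brickWallGraph Q) (hPn : #P = n) (hQn : #Q = n) (hn : 3 ≤ n)
  (hK1 : Corridor P Q) (h : IsT2 P Q t)
include hP hQ hPn hQn hn hK1 h

set_option maxHeartbeats 400000 in
/-- **A T2′ decomposition imposes the forward staggered cut on every traversal of the joined polygon** that enters `u = t − (0,1)` from
`t + (1,−1)`: `IsStagCut (n+3) u (i+1)`. [cite: Hammond2015SAPJoining, §4.2 pp. 20–24 (arXiv v5: recognising the junction plaquette); Madras1995LatticeAnimalsExponent, §2] -/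
theorem isStagCut_of_isT2 (hu : IsPolyTraversal brickWallGraph (staggeredJoin t P Q) (2 * n + 6) u) {i : ℕ} (h0 : u i = t + ![1, -1])
    (h1 : u (i + 1) = t + ![0, -1]) : IsStagCut (n + 3) u (i + 1) := by
  classical
  have hdisj := disjoint_of_corridor (P := P) (Q := Q) hK1
  obtain ⟨hJ, -⟩ := h.isPolygon_join hP hQ hdisj
  set J := staggeredJoin t P Q with hJdef
  -- vertices and free sites
  have tP : t + ![0, 0] ∈ vertsOf P := mem_vertsOf.2 ⟨_, h.het, by simp⟩
  have dQ : t + ![3, 0] ∈ vertsOf Q := mem_vertsOf.2 ⟨_, h.hew, by simp⟩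
  have f10 := h.hfree (1, 0) (by simp [staggeredFree]); have f11 := h.hfree (1, 1) (by simp [staggeredFree])
  have f21 := h.hfree (2, 1) (by simp [staggeredFree]); have f1m := h.hfree (1, -1) (by simp [staggeredFree])
  have f2m := h.hfree (2, -1) (by simp [staggeredFree]); have f20 := h.hfree (2, 0) (by simp [staggeredFree])
  -- open `P` at `u – t` and `Q` at `c – d`
  have het' : s(t + ![0, -1], t + ![0, 0]) ∈ P := by rw [Sym2.eq_swap]; exact h.het
  obtain ⟨W, hW, hWe, -, hWl, hWs⟩ := hP.exists_isPath_erase het'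
  obtain ⟨W', hW', hW'e, -, hW'l, hW's⟩ := hQ.exists_isPath_erase h.hew
  have hWlen : W.length = n - 1 := by omega
  have hW'len : W'.length = n - 1 := by omega
  have hWJ : ∀ e ∈ W.edges, e ∈ J := fun e he => by
    have : e ∈ P.erase s(t + ![0, 0], t + ![0, -1]) := by rw [Sym2.eq_swap, ← hWe]; exact List.mem_toFinset.2 he
    exact Finset.mem_union_left _ (Finset.mem_union_left _ this)
  have hW'J : ∀ e ∈ W'.edges, e ∈ J := fun e he => by
    have : e ∈ Q.erase s(t + ![3, 1], t + ![3, 0]) := by rw [← hW'e]; exact List.mem_toFinset.2 he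
    exact Finset.mem_union_left _ (Finset.mem_union_right _ this)
  have hWv : ∀ k, W.getVert k ∈ vertsOf P := fun k => mem_vertsOf.2 ((hWs _).1 (W.getVert_mem_support k))
  have hW'v : ∀ k, W'.getVert k ∈ vertsOf Q := fun k => mem_vertsOf.2 ((hW's _).1 (W'.getVert_mem_support k))
  have hWedge : ∀ k, k < W.length → s(W.getVert k, W.getVert (k + 1)) ∈ J := by
    intro k hk
    have hlen : k < W.darts.length := by rw [SimpleGraph.Walk.length_darts]; exact hk
    have hd : W.darts[k] ∈ W.darts := List.getElem_mem hlen
    rw [SimpleGraph.Walk.darts_getElem_eq_getVert k hlen] at hd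
    exact hWJ _ (List.mem_map.2 ⟨_, hd, rfl⟩)
  have hW'edge : ∀ k, k < W'.length → s(W'.getVert k, W'.getVert (k + 1)) ∈ J := by
    intro k hk
    have hlen : k < W'.darts.length := by rw [SimpleGraph.Walk.length_darts]; exact hk
    have hd : W'.darts[k] ∈ W'.darts := List.getElem_mem hlen
    rw [SimpleGraph.Walk.darts_getElem_eq_getVert k hlen] at hd
    exact hW'J _ (List.mem_map.2 ⟨_, hd, rfl⟩)
  -- the eight connector bonds
  have c1 : s(t + ![0, 0], t + ![1, 0]) ∈ J := by simp [hJdef, staggeredJoin]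
  have c2 : s(t + ![1, 0], t + ![1, 1]) ∈ J := by simp [hJdef, staggeredJoin]
  have c3 : s(t + ![1, 1], t + ![2, 1]) ∈ J := by simp [hJdef, staggeredJoin]
  have c4 : s(t + ![2, 1], t + ![3, 1]) ∈ J := by simp [hJdef, staggeredJoin]
  have c5 : s(t + ![0, -1], t + ![1, -1]) ∈ J := by simp [hJdef, staggeredJoin]
  have c6 : s(t + ![1, -1], t + ![2, -1]) ∈ J := by simp [hJdef, staggeredJoin]
  have c7 : s(t + ![2, -1], t + ![2, 0]) ∈ J := by simp [hJdef, staggeredJoin]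
  have c8 : s(t + ![2, 0], t + ![3, 0]) ∈ J := by simp [hJdef, staggeredJoin]
  -- STEP 1: the `P`-arc, `u (i+1+k) = W_k`
  have hu2 : u (i + 2) = W.getVert 1 := by
    refine next_eq₂ (i := i) hu hJ (x := t + ![1, -1]) (y := W.getVert 1) (by rw [h1]; exact c5) ?_ ?_ h0
    · rw [h1]; have := hWedge 0 (by omega); rwa [Walk.getVert_zero] at this
    · intro he; exact f1m.1 (he ▸ hWv 1)
  have hP_arc : ∀ k, k ≤ n - 1 → u (i + 1 + k) = W.getVert k := fun k hk =>
    hu.follows_path hJ W hW hWJ (i := i + 1) h1 (fun _ => by rw [show i + 1 + 1 = i + 2 by omega]; exact hu2) k (by omega)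
  have hun : u (i + n) = t + ![0, 0] := by
    have := hP_arc (n - 1) le_rfl
    rw [show i + 1 + (n - 1) = i + n by omega, ← hWlen, Walk.getVert_length] at this; exact this
  have hun1 : u (i + n - 1) = W.getVert (n - 2) := by
    have := hP_arc (n - 2) (by omega); rwa [show i + 1 + (n - 2) = i + n - 1 by omega] at this
  -- STEP 2: the upper connector `t → (1,0) → (1,1) → (2,1) → c`
  have hWlast : s(t + ![0, 0], W.getVert (n - 2)) ∈ J := by
    have := hWedge (n - 2) (by omega)
    rw [show n - 2 + 1 = n - 1 by omega, ← hWlen, Walk.getVert_length, Sym2.eq_swap] at this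
    exact this
  have hA1 : u (i + n + 1) = t + ![1, 0] := by
    have := next_eq₂ (i := i + n - 1) hu hJ (x := W.getVert (n - 2)) (y := t + ![1, 0])
      (by rw [show i + n - 1 + 1 = i + n by omega, hun]; exact hWlast) (by rw [show i + n - 1 + 1 = i + n by omega, hun]; exact c1)
      (fun he => f10.1 (he ▸ hWv (n - 2))) hun1
    rwa [show i + n - 1 + 2 = i + n + 1 by omega] at this
  have hA2 : u (i + n + 2) = t + ![1, 1] :=
    next_eq₂ (i := i + n) hu hJ (x := t + ![0, 0]) (y := t + ![1, 1]) (by rw [hA1, Sym2.eq_swap]; exact c1) (by rw [hA1]; exact c2)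
      (off_ne₂ (by decide)) hun
  have hA3 : u (i + n + 3) = t + ![2, 1] :=
    next_eq₂ (i := i + n + 1) hu hJ (x := t + ![1, 0]) (y := t + ![2, 1]) (by rw [hA2, Sym2.eq_swap]; exact c2) (by rw [hA2]; exact c3)
      (off_ne₂ (by decide)) hA1
  have hA4 : u (i + n + 4) = t + ![3, 1] :=
    next_eq₂ (i := i + n + 2) hu hJ (x := t + ![1, 1]) (y := t + ![3, 1]) (by rw [hA3, Sym2.eq_swap]; exact c3) (by rw [hA3]; exact c4)
      (off_ne₂ (by decide)) hA2
  -- STEP 3: the `Q`-arc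
  have hA5 : u (i + n + 5) = W'.getVert 1 := by
    refine next_eq₂ (i := i + n + 3) hu hJ (x := t + ![2, 1]) (y := W'.getVert 1) (by rw [hA4, Sym2.eq_swap]; exact c4) ?_ ?_ hA3
    · rw [hA4]; have := hW'edge 0 (by omega); rwa [Walk.getVert_zero] at this
    · intro he; exact f21.2 (he ▸ hW'v 1)
  have hQ_arc : ∀ k, k ≤ n - 1 → u (i + n + 4 + k) = W'.getVert k := fun k hk =>
    hu.follows_path hJ W' hW' hW'J (i := i + n + 4) hA4 (fun _ => by rw [show i + n + 4 + 1 = i + n + 5 by omega]; exact hA5) k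
      (by omega)
  have hud : u (i + 2 * n + 3) = t + ![3, 0] := by
    have := hQ_arc (n - 1) le_rfl
    rw [show i + n + 4 + (n - 1) = i + 2 * n + 3 by omega, ← hW'len, Walk.getVert_length] at this; exact this
  have hud1 : u (i + 2 * n + 2) = W'.getVert (n - 2) := by
    have := hQ_arc (n - 2) (by omega); rwa [show i + n + 4 + (n - 2) = i + 2 * n + 2 by omega] at this
  -- STEP 4: the lower connector `d → (2,0) → (2,−1) → (1,−1)`
  have hW'last : s(t + ![3, 0], W'.getVert (n - 2)) ∈ J := by
    have := hW'edge (n - 2) (by omega)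
    rw [show n - 2 + 1 = n - 1 by omega, ← hW'len, Walk.getVert_length, Sym2.eq_swap] at this
    exact this
  have hB1 : u (i + 2 * n + 4) = t + ![2, 0] := by
    have := next_eq₂ (i := i + 2 * n + 2) hu hJ (x := W'.getVert (n - 2)) (y := t + ![2, 0])
      (by rw [show i + 2 * n + 2 + 1 = i + 2 * n + 3 by omega, hud]; exact hW'last)
      (by rw [show i + 2 * n + 2 + 1 = i + 2 * n + 3 by omega, hud, Sym2.eq_swap]; exact c8)
      (fun he => f20.2 (he ▸ hW'v (n - 2))) hud1
    rwa [show i + 2 * n + 2 + 2 = i + 2 * n + 4 by omega] at this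
  have hB2 : u (i + 2 * n + 5) = t + ![2, -1] := by
    have := next_eq₂ (i := i + 2 * n + 3) hu hJ (x := t + ![3, 0]) (y := t + ![2, -1]) (by rw [hB1]; exact c8)
      (by rw [hB1, Sym2.eq_swap]; exact c7) (off_ne₂ (by decide)) hud
    rwa [show i + 2 * n + 3 + 2 = i + 2 * n + 5 by omega] at this
  have hB3 : u (i + 2 * n + 6) = t + ![1, -1] := by rw [show i + 2 * n + 6 = i + (2 * n + 6) by omega, hu.periodic, h0]
  -- the cut
  refine isStagCut_of_eqs t h1 (by rw [show i + 1 + (n + 3) - 4 = i + n by omega, hun])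
    (by rw [show i + 1 + (n + 3) - 3 = i + n + 1 by omega, hA1]) (by rw [show i + 1 + (n + 3) - 2 = i + n + 2 by omega, hA2])
    (by rw [show i + 1 + (n + 3) - 1 = i + n + 3 by omega, hA3]) (by rw [show i + 1 + (n + 3) = i + n + 4 by omega, hA4])
    (by rw [show i + 1 + 2 * (n + 3) - 4 = i + 2 * n + 3 by omega, hud]) (by rw [show i + 1 + 2 * (n + 3) - 3 = i + 2 * n + 4 by omega, hB1])
    (by rw [show i + 1 + 2 * (n + 3) - 2 = i + 2 * n + 5 by omega, hB2]) (by rw [show i + 1 + 2 * (n + 3) - 1 = i + 2 * n + 6 by omega, hB3]) ?_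
  -- row separation of the two blocks
  intro a b ha1 ha2 hb1 hb2 hrow
  have haL : u a ∈ vertsOf P ∨ (u a = t + ![1, 0] ∨ u a = t + ![1, 1] ∨ u a = t + ![2, 1]) := by
    rcases Nat.lt_or_ge a (i + n + 1) with hlt | hge
    · left
      have := hP_arc (a - (i + 1)) (by omega)
      rw [show i + 1 + (a - (i + 1)) = a by omega] at this
      rw [this]; exact hWv _
    · right
      rcases Nat.lt_or_ge a (i + n + 2) with h1' | h1'
      · left; rw [show a = i + n + 1 by omega]; exact hA1
      rcases Nat.lt_or_ge a (i + n + 3) with h2' | h2'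
      · right; left; rw [show a = i + n + 2 by omega]; exact hA2
      · right; right; rw [show a = i + n + 3 by omega]; exact hA3
  have hbR : u b ∈ vertsOf Q ∨ (u b = t + ![2, 0] ∨ u b = t + ![2, -1] ∨ u b = t + ![1, -1]) := by
    rcases Nat.lt_or_ge b (i + 2 * n + 4) with hlt | hge
    · left
      have := hQ_arc (b - (i + n + 4)) (by omega)
      rw [show i + n + 4 + (b - (i + n + 4)) = b by omega] at this
      rw [this]; exact hW'v _
    · right
      rcases Nat.lt_or_ge b (i + 2 * n + 5) with h1' | h1'
      · left; rw [show b = i + 2 * n + 4 by omega]; exact hB1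
      rcases Nat.lt_or_ge b (i + 2 * n + 6) with h2' | h2'
      · right; left; rw [show b = i + 2 * n + 5 by omega]; exact hB2
      · right; right; rw [show b = i + 2 * n + 6 by omega]; exact hB3
  rcases haL with haP | hj <;> rcases hbR with hbQ | hj'
  · exact lt_of_lt_of_le (by omega) (hK1 _ haP _ hbQ (Or.inl hrow))
  · -- `u a ∈ P` against a lower-connector site: corridor against `d = t + (3,0) ∈ Q`, and `t + (1,−1)` is free
    rcases hj' with hbE | hbE | hbE <;> rw [hbE] at hrow ⊢
    · have := hK1 _ haP _ dQ (by simp at hrow ⊢; omega); simp at this ⊢; omega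
    · have := hK1 _ haP _ dQ (by simp at hrow ⊢; omega); simp at this ⊢; omega
    · have := hK1 _ haP _ dQ (by simp at hrow ⊢; omega)
      simp at this hrow ⊢
      rcases lt_or_eq_of_le (show u a 0 ≤ t 0 + 1 by omega) with hlt | heq
      · omega
      · exact absurd haP (by rw [eq_off₂ (t := t) heq hrow]; exact f1m.1)
  · -- an upper-connector site against `u b ∈ Q`: corridor against `t ∈ P`, and `t + (2,1)` is free
    rcases hj with haE | haE | haE <;> rw [haE] at hrow ⊢
    · have := hK1 _ tP _ hbQ (by simp at hrow ⊢; omega); simp at this ⊢; omega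
    · have := hK1 _ tP _ hbQ (by simp at hrow ⊢; omega); simp at this ⊢; omega
    · have := hK1 _ tP _ hbQ (by simp at hrow ⊢; omega)
      simp at this hrow ⊢
      rcases lt_or_eq_of_le (show t 0 + 2 ≤ u b 0 by omega) with hlt | heq
      · omega
      · exact absurd hbQ (by rw [eq_off₂ (t := t) heq.symm hrow.symm]; exact f21.2)
  · rcases hj with haE | haE | haE <;> rcases hj' with hbE | hbE | hbE <;> rw [haE, hbE] at hrow ⊢ <;>
      (simp only [Pi.add_apply, uw0, uw1] at hrow ⊢; omega)

set_option maxHeartbeats 400000 in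
/-- **A T2′ decomposition imposes the BACKWARD staggered cut on every traversal leaving `u = t − (0,1)` towards `t + (1,−1)`**:
`IsStagCut' (n+3) u (i+1)`. [cite: Hammond2015SAPJoining, §4.2 pp. 20–24 (arXiv v5); Madras1995LatticeAnimalsExponent, §2] -/
theorem isStagCut'_of_isT2 (hu : IsPolyTraversal brickWallGraph (staggeredJoin t P Q) (2 * n + 6) u) {i : ℕ} (h0 : u i = t + ![0, -1])
    (h1 : u (i + 1) = t + ![1, -1]) : IsStagCut' (n + 3) u (i + 1) := by
  classical
  have hdisj := disjoint_of_corridor (P := P) (Q := Q) hK1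
  obtain ⟨hJ, -⟩ := h.isPolygon_join hP hQ hdisj
  set J := staggeredJoin t P Q with hJdef
  have tP : t + ![0, 0] ∈ vertsOf P := mem_vertsOf.2 ⟨_, h.het, by simp⟩
  have dQ : t + ![3, 0] ∈ vertsOf Q := mem_vertsOf.2 ⟨_, h.hew, by simp⟩
  have f10 := h.hfree (1, 0) (by simp [staggeredFree]); have f11 := h.hfree (1, 1) (by simp [staggeredFree])
  have f21 := h.hfree (2, 1) (by simp [staggeredFree]); have f1m := h.hfree (1, -1) (by simp [staggeredFree])
  have f2m := h.hfree (2, -1) (by simp [staggeredFree]); have f20 := h.hfree (2, 0) (by simp [staggeredFree])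
  -- open `P` at `t – u` (path `t → … → u`) and `Q` at `d – c` (path `d → … → c`)
  obtain ⟨W, hW, hWe, -, hWl, hWs⟩ := hP.exists_isPath_erase h.het
  have hew' : s(t + ![3, 0], t + ![3, 1]) ∈ Q := by rw [Sym2.eq_swap]; exact h.hew
  obtain ⟨W', hW', hW'e, -, hW'l, hW's⟩ := hQ.exists_isPath_erase hew'
  have hWlen : W.length = n - 1 := by omega
  have hW'len : W'.length = n - 1 := by omega
  have hWJ : ∀ e ∈ W.edges, e ∈ J := fun e he => by
    have : e ∈ P.erase s(t + ![0, 0], t + ![0, -1]) := by rw [← hWe]; exact List.mem_toFinset.2 he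
    exact Finset.mem_union_left _ (Finset.mem_union_left _ this)
  have hW'J : ∀ e ∈ W'.edges, e ∈ J := fun e he => by
    have : e ∈ Q.erase s(t + ![3, 1], t + ![3, 0]) := by rw [Sym2.eq_swap, ← hW'e]; exact List.mem_toFinset.2 he
    exact Finset.mem_union_left _ (Finset.mem_union_right _ this)
  have hWv : ∀ k, W.getVert k ∈ vertsOf P := fun k => mem_vertsOf.2 ((hWs _).1 (W.getVert_mem_support k))
  have hW'v : ∀ k, W'.getVert k ∈ vertsOf Q := fun k => mem_vertsOf.2 ((hW's _).1 (W'.getVert_mem_support k))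
  have hWedge : ∀ k, k < W.length → s(W.getVert k, W.getVert (k + 1)) ∈ J := by
    intro k hk
    have hlen : k < W.darts.length := by rw [SimpleGraph.Walk.length_darts]; exact hk
    have hd : W.darts[k] ∈ W.darts := List.getElem_mem hlen
    rw [SimpleGraph.Walk.darts_getElem_eq_getVert k hlen] at hd
    exact hWJ _ (List.mem_map.2 ⟨_, hd, rfl⟩)
  have hW'edge : ∀ k, k < W'.length → s(W'.getVert k, W'.getVert (k + 1)) ∈ J := by
    intro k hk
    have hlen : k < W'.darts.length := by rw [SimpleGraph.Walk.length_darts]; exact hk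
    have hd : W'.darts[k] ∈ W'.darts := List.getElem_mem hlen
    rw [SimpleGraph.Walk.darts_getElem_eq_getVert k hlen] at hd
    exact hW'J _ (List.mem_map.2 ⟨_, hd, rfl⟩)
  have c1 : s(t + ![0, 0], t + ![1, 0]) ∈ J := by simp [hJdef, staggeredJoin]
  have c2 : s(t + ![1, 0], t + ![1, 1]) ∈ J := by simp [hJdef, staggeredJoin]
  have c3 : s(t + ![1, 1], t + ![2, 1]) ∈ J := by simp [hJdef, staggeredJoin]
  have c4 : s(t + ![2, 1], t + ![3, 1]) ∈ J := by simp [hJdef, staggeredJoin]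
  have c5 : s(t + ![0, -1], t + ![1, -1]) ∈ J := by simp [hJdef, staggeredJoin]
  have c6 : s(t + ![1, -1], t + ![2, -1]) ∈ J := by simp [hJdef, staggeredJoin]
  have c7 : s(t + ![2, -1], t + ![2, 0]) ∈ J := by simp [hJdef, staggeredJoin]
  have c8 : s(t + ![2, 0], t + ![3, 0]) ∈ J := by simp [hJdef, staggeredJoin]
  -- STEP 1: the lower connector `(1,−1) → (2,−1) → (2,0) → d`
  have hB1 : u (i + 2) = t + ![2, -1] :=
    next_eq₂ (i := i) hu hJ (x := t + ![0, -1]) (y := t + ![2, -1]) (by rw [h1, Sym2.eq_swap]; exact c5) (by rw [h1]; exact c6)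
      (off_ne₂ (by decide)) h0
  have hB2 : u (i + 3) = t + ![2, 0] :=
    next_eq₂ (i := i + 1) hu hJ (x := t + ![1, -1]) (y := t + ![2, 0]) (by rw [hB1, Sym2.eq_swap]; exact c6) (by rw [hB1]; exact c7)
      (off_ne₂ (by decide)) h1
  have hB3 : u (i + 4) = t + ![3, 0] :=
    next_eq₂ (i := i + 2) hu hJ (x := t + ![2, -1]) (y := t + ![3, 0]) (by rw [hB2, Sym2.eq_swap]; exact c7) (by rw [hB2]; exact c8)
      (off_ne₂ (by decide)) hB1
  -- STEP 2: the `Q`-arc backwards, `u (i+4+k) = W'_k`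
  have hB4 : u (i + 5) = W'.getVert 1 := by
    refine next_eq₂ (i := i + 3) hu hJ (x := t + ![2, 0]) (y := W'.getVert 1) (by rw [hB3, Sym2.eq_swap]; exact c8) ?_ ?_ hB2
    · rw [hB3]; have := hW'edge 0 (by omega); rwa [Walk.getVert_zero] at this
    · intro he; exact f20.2 (he ▸ hW'v 1)
  have hQ_arc : ∀ k, k ≤ n - 1 → u (i + 4 + k) = W'.getVert k := fun k hk =>
    hu.follows_path hJ W' hW' hW'J (i := i + 4) hB3 (fun _ => by rw [show i + 4 + 1 = i + 5 by omega]; exact hB4) k (by omega)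
  have huc : u (i + n + 3) = t + ![3, 1] := by
    have := hQ_arc (n - 1) le_rfl
    rw [show i + 4 + (n - 1) = i + n + 3 by omega, ← hW'len, Walk.getVert_length] at this; exact this
  have huc1 : u (i + n + 2) = W'.getVert (n - 2) := by
    have := hQ_arc (n - 2) (by omega); rwa [show i + 4 + (n - 2) = i + n + 2 by omega] at this
  -- STEP 3: the upper connector backwards `c → (2,1) → (1,1) → (1,0) → t`
  have hW'last : s(t + ![3, 1], W'.getVert (n - 2)) ∈ J := by
    have := hW'edge (n - 2) (by omega)
    rw [show n - 2 + 1 = n - 1 by omega, ← hW'len, Walk.getVert_length, Sym2.eq_swap] at this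
    exact this
  have hA1 : u (i + n + 4) = t + ![2, 1] := by
    have := next_eq₂ (i := i + n + 2) hu hJ (x := W'.getVert (n - 2)) (y := t + ![2, 1])
      (by rw [show i + n + 2 + 1 = i + n + 3 by omega, huc]; exact hW'last)
      (by rw [show i + n + 2 + 1 = i + n + 3 by omega, huc, Sym2.eq_swap]; exact c4)
      (fun he => f21.2 (he ▸ hW'v (n - 2))) huc1
    rwa [show i + n + 2 + 2 = i + n + 4 by omega] at this
  have hA2 : u (i + n + 5) = t + ![1, 1] := by
    have := next_eq₂ (i := i + n + 3) hu hJ (x := t + ![3, 1]) (y := t + ![1, 1]) (by rw [hA1]; exact c4)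
      (by rw [hA1, Sym2.eq_swap]; exact c3) (off_ne₂ (by decide)) huc
    rwa [show i + n + 3 + 2 = i + n + 5 by omega] at this
  have hA3 : u (i + n + 6) = t + ![1, 0] := by
    have := next_eq₂ (i := i + n + 4) hu hJ (x := t + ![2, 1]) (y := t + ![1, 0]) (by rw [hA2]; exact c3)
      (by rw [hA2, Sym2.eq_swap]; exact c2) (off_ne₂ (by decide)) hA1
    rwa [show i + n + 4 + 2 = i + n + 6 by omega] at this
  have hA4 : u (i + n + 7) = t + ![0, 0] := by
    have := next_eq₂ (i := i + n + 5) hu hJ (x := t + ![1, 1]) (y := t + ![0, 0]) (by rw [hA3]; exact c2)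
      (by rw [hA3, Sym2.eq_swap]; exact c1) (off_ne₂ (by decide)) hA2
    rwa [show i + n + 5 + 2 = i + n + 7 by omega] at this
  -- STEP 4: the `P`-arc backwards, `u (i+n+7+k) = W_k`
  have hA5 : u (i + n + 8) = W.getVert 1 := by
    have := next_eq₂ (i := i + n + 6) hu hJ (x := t + ![1, 0]) (y := W.getVert 1)
      (by rw [show i + n + 6 + 1 = i + n + 7 by omega, hA4]; exact c1) ?_ ?_ hA3
    · rwa [show i + n + 6 + 2 = i + n + 8 by omega] at this
    · rw [show i + n + 6 + 1 = i + n + 7 by omega, hA4]; have := hWedge 0 (by omega); rwa [Walk.getVert_zero] at this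
    · intro he; exact f10.1 (he ▸ hWv 1)
  have hP_arc : ∀ k, k ≤ n - 1 → u (i + n + 7 + k) = W.getVert k := fun k hk =>
    hu.follows_path hJ W hW hWJ (i := i + n + 7) hA4 (fun _ => by rw [show i + n + 7 + 1 = i + n + 8 by omega]; exact hA5) k (by omega)
  have huu : u (i + 2 * n + 6) = t + ![0, -1] := by
    have := hP_arc (n - 1) le_rfl
    rw [show i + n + 7 + (n - 1) = i + 2 * n + 6 by omega, ← hWlen, Walk.getVert_length] at this; exact this
  -- the backward cut
  refine isStagCut'_of_eqs t h1 (by rw [show i + 1 + 1 = i + 2 by omega, hB1]) (by rw [show i + 1 + 2 = i + 3 by omega, hB2])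
    (by rw [show i + 1 + 3 = i + 4 by omega, hB3]) (by rw [show i + 1 + (n + 3) - 1 = i + n + 3 by omega, huc])
    (by rw [show i + 1 + (n + 3) = i + n + 4 by omega, hA1]) (by rw [show i + 1 + (n + 3) + 1 = i + n + 5 by omega, hA2])
    (by rw [show i + 1 + (n + 3) + 2 = i + n + 6 by omega, hA3]) (by rw [show i + 1 + (n + 3) + 3 = i + n + 7 by omega, hA4])
    (by rw [show i + 1 + 2 * (n + 3) - 1 = i + 2 * n + 6 by omega, huu]) ?_
  -- separation: the first block (lower connector, `Q`-arc) lies right of the second (upper connector, `P`-arc)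
  intro a b ha1 ha2 hb1 hb2 hrow
  have haR : u a ∈ vertsOf Q ∨ (u a = t + ![1, -1] ∨ u a = t + ![2, -1] ∨ u a = t + ![2, 0]) := by
    rcases Nat.lt_or_ge a (i + 4) with hlt | hge
    · right
      rcases Nat.lt_or_ge a (i + 2) with h1' | h1'
      · left; rw [show a = i + 1 by omega]; exact h1
      rcases Nat.lt_or_ge a (i + 3) with h2' | h2'
      · right; left; rw [show a = i + 2 by omega]; exact hB1
      · right; right; rw [show a = i + 3 by omega]; exact hB2
    · left
      have := hQ_arc (a - (i + 4)) (by omega)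
      rw [show i + 4 + (a - (i + 4)) = a by omega] at this
      rw [this]; exact hW'v _
  have hbL : u b ∈ vertsOf P ∨ (u b = t + ![2, 1] ∨ u b = t + ![1, 1] ∨ u b = t + ![1, 0]) := by
    rcases Nat.lt_or_ge b (i + n + 7) with hlt | hge
    · right
      rcases Nat.lt_or_ge b (i + n + 5) with h1' | h1'
      · left; rw [show b = i + n + 4 by omega]; exact hA1
      rcases Nat.lt_or_ge b (i + n + 6) with h2' | h2'
      · right; left; rw [show b = i + n + 5 by omega]; exact hA2
      · right; right; rw [show b = i + n + 6 by omega]; exact hA3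
    · left
      have := hP_arc (b - (i + n + 7)) (by omega)
      rw [show i + n + 7 + (b - (i + n + 7)) = b by omega] at this
      rw [this]; exact hWv _
  rcases haR with haQ | hj <;> rcases hbL with hbP | hj'
  · exact lt_of_lt_of_le (by omega) (hK1 _ hbP _ haQ (Or.inl hrow.symm))
  · -- `u a ∈ Q` against an upper-connector site
    rcases hj' with hbE | hbE | hbE <;> rw [hbE] at hrow ⊢
    · have := hK1 _ tP _ haQ (by simp at hrow ⊢; omega)
      simp at this hrow ⊢
      rcases lt_or_eq_of_le (show t 0 + 2 ≤ u a 0 by omega) with hlt | heq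
      · omega
      · exact absurd haQ (by rw [eq_off₂ (t := t) heq.symm hrow]; exact f21.2)
    · have := hK1 _ tP _ haQ (by simp at hrow ⊢; omega); simp at this ⊢; omega
    · have := hK1 _ tP _ haQ (by simp at hrow ⊢; omega); simp at this ⊢; omega
  · -- a lower-connector site against `u b ∈ P`
    rcases hj with haE | haE | haE <;> rw [haE] at hrow ⊢
    · have := hK1 _ hbP _ dQ (by simp at hrow ⊢; omega)
      simp at this hrow ⊢
      rcases lt_or_eq_of_le (show u b 0 ≤ t 0 + 1 by omega) with hlt | heq
      · omega
      · exact absurd hbP (by rw [eq_off₂ (t := t) heq hrow.symm]; exact f1m.1)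
    · have := hK1 _ hbP _ dQ (by simp at hrow ⊢; omega); simp at this ⊢; omega
    · have := hK1 _ hbP _ dQ (by simp at hrow ⊢; omega); simp at this ⊢; omega
  · rcases hj with haE | haE | haE <;> rcases hj' with hbE | hbE | hbE <;> rw [haE, hbE] at hrow ⊢ <;>
      (simp only [Pi.add_apply, uw0, uw1] at hrow ⊢; omega)

end Bridge

/-! ### Same polygon, two T2′ decompositions -/

/-- periodicity downwards for the forward cut (private plumbing). [cite: Hammond2015SAPJoining, Definition 4.3 p. 20 (arXiv v5)] -/
private theorem isStagCut_sub_period {M j : ℕ} {v : ℕ → Site 2} (hM : 4 ≤ M) (hper : ∀ i, v (i + 2 * M) = v i)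
    (h : IsStagCut M v (j + 2 * M)) : IsStagCut M v j := by
  have h' : IsStagCut M (fun i => v (i + 2 * M)) j := isStagCut_shift hM (by rw [Nat.add_comm]; exact h)
  simp only [hper] at h'
  exact h'

/-- periodicity downwards for the backward cut (private plumbing). [cite: Hammond2015SAPJoining, Definition 4.3 p. 20 (arXiv v5)] -/
private theorem isStagCut'_sub_period {M j : ℕ} {v : ℕ → Site 2} (hM : 4 ≤ M) (hper : ∀ i, v (i + 2 * M) = v i)
    (h : IsStagCut' M v (j + 2 * M)) : IsStagCut' M v j := by
  have h' : IsStagCut' M (fun i => v (i + 2 * M)) j := isStagCut'_shift hM (by rw [Nat.add_comm]; exact h)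
  simp only [hper] at h'
  exact h'

/-- **Junction uniqueness for the staggered join, same polygon** (`d = 0`): two T2′ decompositions of the same joined polygon of
corridor-separated `n`-gon pairs have the same contact site. [cite: Hammond2015SAPJoining, §4.2 pp. 20–24 (arXiv v5: the junction plaquette is determined); Madras1995LatticeAnimalsExponent, §2] -/
theorem staggeredJoin_site_unique {P' Q' : Finset (Sym2 (Site 2))} {t' : Site 2}
    (hP : IsPolygon brickWallGraph P) (hQ : IsPolygon brickWallGraph Q) (hP' : IsPolygon brickWallGraph P') (hQ' : IsPolygon brickWallGraph Q')
    (hPn : #P = n) (hQn : #Q = n) (hP'n : #P' = n) (hQ'n : #Q' = n) (hn : 3 ≤ n) (hK1 : Corridor P Q) (hK1' : Corridor P' Q')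
    (h : IsT2 P Q t) (h' : IsT2 P' Q' t') (hJ : staggeredJoin t' P' Q' = staggeredJoin t P Q) : t' = t := by
  classical
  have hdisj := disjoint_of_corridor (P := P) (Q := Q) hK1
  obtain ⟨hJpoly, hJc⟩ := h.isPolygon_join hP hQ hdisj
  have hcard : #(staggeredJoin t P Q) = 2 * n + 6 := by rw [hJc, hPn, hQn]; ring
  -- a traversal entering `u = t − (0,1)` from `t + (1,−1)`
  have c5 : s(t + ![1, -1], t + ![0, -1]) ∈ staggeredJoin t P Q := by rw [Sym2.eq_swap]; simp [staggeredJoin]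
  obtain ⟨u, hu, hu0, hu1⟩ := hJpoly.exists_isPolyTraversal c5
  rw [hcard] at hu
  have hrow : ∀ i, u (i + 1) 1 ≤ u i 1 + 1 ∧ u i 1 ≤ u (i + 1) 1 + 1 := row_step_le_of_adj hu.adj
  have hper : ∀ i, u (i + 2 * (n + 3)) = u i := fun i => by rw [show 2 * (n + 3) = 2 * n + 6 by ring]; exact hu.periodic i
  -- cut of decomposition 1 at index 1
  have cut1 := isStagCut_of_isT2 hP hQ hPn hQn hn hK1 h hu (i := 0) hu0 (by simpa using hu1)
  simp only [Nat.zero_add] at cut1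
  -- locate decomposition 2's bond `t'+(1,−1) – t'−(0,1)` on the traversal
  have c5' : s(t' + ![1, -1], t' + ![0, -1]) ∈ staggeredJoin t P Q := by rw [← hJ, Sym2.eq_swap]; simp [staggeredJoin]
  obtain ⟨i, hi, hie⟩ := hu.surj _ c5'
  have hu' : IsPolyTraversal brickWallGraph (staggeredJoin t' P' Q') (2 * n + 6) u := by rw [hJ]; exact hu
  rcases Sym2.eq_iff.1 hie with ⟨ha, hb⟩ | ⟨ha, hb⟩
  · -- same orientation: forward cut at `i + 1`; uniqueness forces `i = 0`
    have cut2 := isStagCut_of_isT2 hP' hQ' hP'n hQ'n hn hK1' h' hu' (i := i) ha hb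
    rcases Nat.lt_or_ge (i + 1) (2 * (n + 3)) with hlt | hge
    · have := isStagCut_unique (by omega) hper (by omega) hlt cut1 cut2
      have e : u 1 = u (i + 1) := by rw [← this]
      rw [hu1, hb] at e
      exact (add_right_cancel e).symm
    · have hi' : i + 1 = 0 + 2 * (n + 3) := by omega
      rw [hi'] at cut2
      have := isStagCut_unique (by omega) hper (by omega) (by omega) cut1 (isStagCut_sub_period (by omega) hper cut2)
      omega
  · -- opposite orientation: a backward cut at `i + 1` next to the forward cut at `1` — impossible
    exfalso
    have cut2 := isStagCut'_of_isT2 hP' hQ' hP'n hQ'n hn hK1' h' hu' (i := i) ha hb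
    rcases Nat.lt_or_ge (i + 1) (2 * (n + 3)) with hlt | hge
    · exact not_isStagCut'_of_isStagCut (by omega) hper hrow (by omega) hlt cut1 cut2
    · have hi' : i + 1 = 0 + 2 * (n + 3) := by omega
      rw [hi'] at cut2
      exact not_isStagCut'_of_isStagCut (by omega) hper hrow (by omega) (by omega) cut1 (isStagCut'_sub_period (by omega) hper cut2)

/-! ### Translation and `JU2` -/

/-- a bond translated (private plumbing). [folklore] -/
private theorem mem_shift_of_mem₂ {E : Finset (Sym2 (Site 2))} {a b d : Site 2} (h : s(a, b) ∈ E) : s(a + d, b + d) ∈ shiftEdges d E :=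
  mem_shiftEdges_iff.2 ⟨_, h, by rw [Sym2.map_mk]⟩

/-- offsets commute with the translation (private plumbing). [folklore] -/
private theorem add_off₂ (t d v : Site 2) : t + d + v = t + v + d := add_right_comm t d v

/-- The T2′ bundle is covariant under EVEN translations. [cite: Hammond2015SAPJoining, Definition 4.3 p. 20 (arXiv v5)] -/
theorem isT2_shift (h : IsT2 P Q t) {d : Site 2} (hd : (d 0 + d 1) % 2 = 0) : IsT2 (shiftEdges d P) (shiftEdges d Q) (t + d) := by
  have nv : ∀ {E : Finset (Sym2 (Site 2))} {v : Site 2}, t + v ∉ vertsOf E → t + d + v ∉ vertsOf (shiftEdges d E) :=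
    fun {E} {v} hv hh => hv (by rw [mem_vertsOf_shiftEdges, add_off₂, add_sub_cancel_right] at hh; exact hh)
  refine ⟨?_, ?_, ?_, fun ab hab => ⟨nv (h.hfree ab hab).1, nv (h.hfree ab hab).2⟩⟩
  · have := h.hpar; simp only [Pi.add_apply]; omega
  · rw [add_off₂, add_off₂ t d]; exact mem_shift_of_mem₂ h.het
  · rw [add_off₂, add_off₂ t d]; exact mem_shift_of_mem₂ h.hew

/-- The staggered join is covariant under even translations. [cite: Hammond2015SAPJoining, Definition 4.3 p. 20 (arXiv v5)] -/
theorem staggeredJoin_shift (h : IsT2 P Q t) (hdisj : ∀ x, x ∈ vertsOf P → x ∈ vertsOf Q → False) {d : Site 2}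
    (hd : (d 0 + d 1) % 2 = 0) :
    staggeredJoin (t + d) (shiftEdges d P) (shiftEdges d Q) = shiftEdges d (staggeredJoin t P Q) := by
  classical
  have hdisj' : ∀ x, x ∈ vertsOf (shiftEdges d P) → x ∈ vertsOf (shiftEdges d Q) → False := fun x hx hy =>
    hdisj (x - d) (mem_vertsOf_shiftEdges.1 hx) (mem_vertsOf_shiftEdges.1 hy)
  rw [staggeredJoin_eq_symmDiff (isT2_shift h hd) hdisj', staggeredJoin_eq_symmDiff h hdisj, bdry_add]
  unfold shiftEdges
  rw [Finset.image_symmDiff _ _ (Sym2.map.injective (add_left_injective d)), Finset.image_union]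

/-- **`JU2` holds**: junction uniqueness for the staggered double-brick join (type T2′). [cite: Hammond2015SAPJoining, §4.2 pp. 20–24 (arXiv v5: the junction plaquette is determined by the joined polygon); Madras1995LatticeAnimalsExponent, §2] -/
theorem ju2 : JU2 := by
  intro P Q P' Q' t t' d n hP hQ hP' hQ' hPn hQn hP'n hQ'n hK1 hK1' h h' hJ
  classical
  have hdisj := disjoint_of_corridor (P := P) (Q := Q) hK1
  have hn : 3 ≤ n := by
    obtain ⟨w, c, hc, hcE⟩ := hP
    rw [← hPn, ← hcE, List.toFinset_card_of_nodup hc.edges_nodup, Walk.length_edges]; exact hc.three_le_length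
  by_cases hd : (d 0 + d 1) % 2 = 0
  · have hPd := PolygonConcat.isPolygon_shiftEdges_of_even hP hd
    have hQd := PolygonConcat.isPolygon_shiftEdges_of_even hQ hd
    exact staggeredJoin_site_unique (P := shiftEdges d P) (Q := shiftEdges d Q) (t := t + d) (n := n) hPd hQd hP' hQ'
      (by rw [card_shiftEdges, hPn]) (by rw [card_shiftEdges, hQn]) hP'n hQ'n hn (hK1.shift d) hK1' (isT2_shift h hd) h'
      (by rw [hJ, staggeredJoin_shift h hdisj hd])
  · -- `d` odd is impossible: the vertical connector bond `t+(1,0) – t+(1,1)` of `J` would translate to a non-bond of the brick wall in `J'`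
    exfalso
    have c2 : s(t + ![1, 0], t + ![1, 1]) ∈ staggeredJoin t P Q := by simp [staggeredJoin]
    have hmemJ' : s(t + ![1, 0] + d, t + ![1, 1] + d) ∈ staggeredJoin t' P' Q' := by rw [hJ]; exact mem_shift_of_mem₂ c2
    have hdisj' := disjoint_of_corridor (P := P') (Q := Q') hK1'
    have hJ'poly := (h'.isPolygon_join hP' hQ' hdisj').1
    have hadj : brickWallGraph.Adj (t + ![1, 0] + d) (t + ![1, 1] + d) := IsPolygon.mem_edgeSet hJ'poly hmemJ'
    rw [brickWallGraph_adj_coord] at hadj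
    have ht := h.hpar
    simp only [Pi.add_apply] at hadj
    simp at hadj
    omega

end Assembly

end HexBW

end Literature.Probability.RandomPlanarGeometry.SAW

end


/-!
# Junction uniqueness for the capless Madras join on `ℍ`, type T4′ (`JU4`): the reflected staggered double brick is determined by the joined polygon

Topic `Literature/Probability/RandomPlanarGeometry` (lane «pcv-sawmu», a-p4 g13; stub E5a of LINE «HEX-MADRAS», third of the five junction
types of `HexSAWPolygonJoinAssembly.JunctionUnique`; the `y ↦ −y` mirror of `HexSAWPolygonJunctionUniqueT2` (`ju2`)).

Type T4′ is the staggered double brick with the contact site\'s vertical bond pointing UP (`HexSAWPolygonJunctions.staggeredJoin'`).  Its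
junction is the mirror image `y ↦ −y` of the T2′ junction, so a T4′ decomposition `(P, Q, t)` of `J = staggeredJoin' t P Q` forces the MIRRORED
traversal `k ↦ (u_k⁰, −u_k¹)` of `J` to carry the cut predicates of `HexSAWPolygonStaggeredCut` (`IsStagCut`, forward; `IsStagCut'`, backward) —
the mirror preserves columns, hence the left/right separation, and `2M`-periodicity and the row hypothesis.  Uniqueness
(`isStagCut_unique`, `not_isStagCut'_of_isStagCut`) then applies verbatim to the mirrored traversal.

## Main statements (namespace `…SAW.HexBW.Assembly`)
* `isStagCut_of_isT4`, `isStagCut'_of_isT4` — the bridge (mirrored traversal), both orientations;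
* `staggeredJoin'_site_unique`; `isT4_shift`, `staggeredJoin'_shift`; **`ju4 : JU4`**.
[cite: Hammond2015SAPJoining, Definition 4.3 p. 20 and §4.2 pp. 20–24 (arXiv v5: the junction plaquette of the Madras join is recognisable)]
[cite: Madras1995LatticeAnimalsExponent, §2 (primary, not held)] [cite: MadrasSlade1993, Definition 3.2.1 p. 62; Theorem 3.2.3 proof pp. 64–65].
-/

noncomputable section

open SimpleGraph Finset Literature.Probability.LatticeModels Literature.Probability.Percolation
open Literature.Barriers.CriticalPhenomena.SupercriticalSAW (shiftEdges card_shiftEdges mem_shiftEdges_iff shiftEdges_injective)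
open Literature.Probability.Percolation.SiteGadgetSystem (vertsOf mem_vertsOf)

namespace Literature.Probability.RandomPlanarGeometry.SAW

namespace HexBW

namespace Assembly

variable {P Q : Finset (Sym2 (Site 2))} {t : Site 2} {n : ℕ} {u : ℕ → Site 2}

/-- `![a, b] 0 = a` (private plumbing). [folklore] -/
@[simp] private theorem ux0 (a b : ℤ) : (![a, b] : Site 2) 0 = a := rfl
/-- `![a, b] 1 = b` (private plumbing). [folklore] -/
@[simp] private theorem ux1 (a b : ℤ) : (![a, b] : Site 2) 1 = b := rfl

/-! ### Plumbing -/

/-- the next site of a traversal at a vertex with two known polygon bonds (private plumbing). [cite: MadrasSlade1993, Definition 3.2.1 p. 62 (degree two)] -/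
private theorem next_eq₄ {E : Finset (Sym2 (Site 2))} {L : ℕ} (hu : IsPolyTraversal brickWallGraph E L u) (hE : IsPolygon brickWallGraph E)
    {i : ℕ} {x y : Site 2} (hx : s(u (i + 1), x) ∈ E) (hy : s(u (i + 1), y) ∈ E) (hxy : x ≠ y) (hprev : u i = x) :
    u (i + 2) = y := by
  have hm : s(u (i + 1), u (i + 1 + 1)) ∈ E := hu.mem (i + 1)
  rcases hE.eq_or_eq_of_mem hx hy hxy hm with h | h
  · exact absurd (h.trans hprev.symm) (hu.ne_succ_succ i)
  · exact h

/-- two distinct offsets give distinct sites (private plumbing). [folklore] -/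
private theorem off_ne₄ {a b c d : ℤ} (h : (a, b) ≠ (c, d)) : t + ![a, b] ≠ t + ![c, d] := by
  intro he
  have h0 := congrArg (fun z : Site 2 => z 0) he
  have h1 := congrArg (fun z : Site 2 => z 1) he
  simp at h0 h1
  exact h (Prod.ext h0 h1)

/-- a site with prescribed offsets from `t` (private plumbing). [folklore] -/
private theorem eq_off₄ {x : Site 2} {a b : ℤ} (h0 : x 0 = t 0 + a) (h1 : x 1 = t 1 + b) : x = t + ![a, b] := by
  ext k; fin_cases k <;> simp [h0, h1]

/-- `IsStagCut` of the MIRRORED sequence from the ten junction values of a T4′ reading (private plumbing).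
[cite: Hammond2015SAPJoining, Definition 4.3 p. 20 (arXiv v5)] -/
private theorem isStagCut_of_eqs_mirror {M j : ℕ} {v : ℕ → Site 2} (p : Site 2) (h0 : v j = p + ![0, 1]) (h1 : v (j + M - 4) = p + ![0, 0])
    (h2 : v (j + M - 3) = p + ![1, 0]) (h3 : v (j + M - 2) = p + ![1, -1]) (h4 : v (j + M - 1) = p + ![2, -1]) (h5 : v (j + M) = p + ![3, -1])
    (h6 : v (j + 2 * M - 4) = p + ![3, 0]) (h7 : v (j + 2 * M - 3) = p + ![2, 0]) (h8 : v (j + 2 * M - 2) = p + ![2, 1])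
    (h9 : v (j + 2 * M - 1) = p + ![1, 1])
    (sep : ∀ a b : ℕ, j ≤ a → a < j + M → j + M ≤ b → b < j + 2 * M → v a 1 = v b 1 → v a 0 < v b 0) :
    IsStagCut M (fun k => ![v k 0, -(v k 1)]) j := by
  refine ⟨⟨?_, ?_⟩, ⟨?_, ?_⟩, ⟨?_, ?_⟩, ⟨?_, ?_⟩, ⟨?_, ?_⟩, ⟨?_, ?_⟩, ⟨?_, ?_⟩, ⟨?_, ?_⟩, ⟨?_, ?_⟩, ?_⟩
  · simp only [ux0]; rw [h1, h0]; simp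
  · simp only [ux1]; rw [h1, h0]; simp
  · simp only [ux0]; rw [h2, h0]; simp
  · simp only [ux1]; rw [h2, h0]; simp
  · simp only [ux0]; rw [h3, h0]; simp
  · simp only [ux1]; rw [h3, h0]; simp; ring
  · simp only [ux0]; rw [h4, h0]; simp
  · simp only [ux1]; rw [h4, h0]; simp; ring
  · simp only [ux0]; rw [h5, h0]; simp
  · simp only [ux1]; rw [h5, h0]; simp; ring
  · simp only [ux0]; rw [h6, h0]; simp
  · simp only [ux1]; rw [h6, h0]; simp
  · simp only [ux0]; rw [h7, h0]; simp
  · simp only [ux1]; rw [h7, h0]; simp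
  · simp only [ux0]; rw [h8, h0]; simp
  · simp only [ux1]; rw [h8, h0]; simp
  · simp only [ux0]; rw [h9, h0]; simp
  · simp only [ux1]; rw [h9, h0]; simp
  · intro a b ha1 ha2 hb1 hb2 hr
    simp only [ux0, ux1, neg_inj] at hr ⊢
    exact sep a b ha1 ha2 hb1 hb2 hr

/-- `IsStagCut'` of the mirrored sequence from the ten junction values of a backward T4′ reading (private plumbing).
[cite: Hammond2015SAPJoining, Definition 4.3 p. 20 (arXiv v5)] -/
private theorem isStagCut'_of_eqs_mirror {M j : ℕ} {v : ℕ → Site 2} (p : Site 2) (h0 : v j = p + ![1, 1]) (h1 : v (j + 1) = p + ![2, 1])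
    (h2 : v (j + 2) = p + ![2, 0]) (h3 : v (j + 3) = p + ![3, 0]) (h4 : v (j + M - 1) = p + ![3, -1]) (h5 : v (j + M) = p + ![2, -1])
    (h6 : v (j + M + 1) = p + ![1, -1]) (h7 : v (j + M + 2) = p + ![1, 0]) (h8 : v (j + M + 3) = p + ![0, 0])
    (h9 : v (j + 2 * M - 1) = p + ![0, 1])
    (sep : ∀ a b : ℕ, j ≤ a → a < j + M → j + M ≤ b → b < j + 2 * M → v a 1 = v b 1 → v b 0 < v a 0) :
    IsStagCut' M (fun k => ![v k 0, -(v k 1)]) j := by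
  refine ⟨⟨?_, ?_⟩, ⟨?_, ?_⟩, ⟨?_, ?_⟩, ⟨?_, ?_⟩, ⟨?_, ?_⟩, ⟨?_, ?_⟩, ⟨?_, ?_⟩, ⟨?_, ?_⟩, ⟨?_, ?_⟩, ?_⟩
  · simp only [ux0]; rw [h1, h0]; simp; ring
  · simp only [ux1]; rw [h1, h0]; simp
  · simp only [ux0]; rw [h2, h0]; simp; ring
  · simp only [ux1]; rw [h2, h0]; simp
  · simp only [ux0]; rw [h3, h0]; simp; ring
  · simp only [ux1]; rw [h3, h0]; simp
  · simp only [ux0]; rw [h4, h0]; simp; ring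
  · simp only [ux1]; rw [h4, h0]; simp; ring
  · simp only [ux0]; rw [h5, h0]; simp; ring
  · simp only [ux1]; rw [h5, h0]; simp; ring
  · simp only [ux0]; rw [h6, h0]; simp
  · simp only [ux1]; rw [h6, h0]; simp; ring
  · simp only [ux0]; rw [h7, h0]; simp
  · simp only [ux1]; rw [h7, h0]; simp
  · simp only [ux0]; rw [h8, h0]; simp
  · simp only [ux1]; rw [h8, h0]; simp
  · simp only [ux0]; rw [h9, h0]; simp
  · simp only [ux1]; rw [h9, h0]; simp
  · intro a b ha1 ha2 hb1 hb2 hr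
    simp only [ux0, ux1, neg_inj] at hr ⊢
    exact sep a b ha1 ha2 hb1 hb2 hr

section Bridge

variable (hP : IsPolygon brickWallGraph P) (hQ : IsPolygon brickWallGraph Q) (hPn : #P = n) (hQn : #Q = n) (hn : 3 ≤ n)
  (hK1 : Corridor P Q) (h : IsT4 P Q t)
include hP hQ hPn hQn hn hK1 h

set_option maxHeartbeats 400000 in
/-- **A T4′ decomposition imposes the forward staggered cut on the MIRROR `y ↦ −y` of every traversal of the joined polygon** that enters
`u = t + (0,1)` from `t + (1,1)`. [cite: Hammond2015SAPJoining, §4.2 pp. 20–24 (arXiv v5: recognising the junction plaquette); Madras1995LatticeAnimalsExponent, §2] -/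
theorem isStagCut_of_isT4 (hu : IsPolyTraversal brickWallGraph (staggeredJoin' t P Q) (2 * n + 6) u) {i : ℕ} (h0 : u i = t + ![1, 1])
    (h1 : u (i + 1) = t + ![0, 1]) : IsStagCut (n + 3) (fun k => ![u k 0, -(u k 1)]) (i + 1) := by
  classical
  have hdisj := disjoint_of_corridor (P := P) (Q := Q) hK1
  obtain ⟨hJ, -⟩ := h.isPolygon_join hP hQ hdisj
  set J := staggeredJoin' t P Q with hJdef
  -- vertices and free sites
  have tP : t + ![0, 0] ∈ vertsOf P := mem_vertsOf.2 ⟨_, h.het, by simp⟩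
  have dQ : t + ![3, 0] ∈ vertsOf Q := mem_vertsOf.2 ⟨_, h.hew, by simp⟩
  have f10 := h.hfree (1, 0) (by simp [staggeredFree']); have f11 := h.hfree (1, -1) (by simp [staggeredFree'])
  have f21 := h.hfree (2, -1) (by simp [staggeredFree']); have f1m := h.hfree (1, 1) (by simp [staggeredFree'])
  have f2m := h.hfree (2, 1) (by simp [staggeredFree']); have f20 := h.hfree (2, 0) (by simp [staggeredFree'])
  -- open `P` at `u – t` and `Q` at `c – d`
  have het' : s(t + ![0, 1], t + ![0, 0]) ∈ P := by rw [Sym2.eq_swap]; exact h.het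
  obtain ⟨W, hW, hWe, -, hWl, hWs⟩ := hP.exists_isPath_erase het'
  obtain ⟨W', hW', hW'e, -, hW'l, hW's⟩ := hQ.exists_isPath_erase h.hew
  have hWlen : W.length = n - 1 := by omega
  have hW'len : W'.length = n - 1 := by omega
  have hWJ : ∀ e ∈ W.edges, e ∈ J := fun e he => by
    have : e ∈ P.erase s(t + ![0, 0], t + ![0, 1]) := by rw [Sym2.eq_swap, ← hWe]; exact List.mem_toFinset.2 he
    exact Finset.mem_union_left _ (Finset.mem_union_left _ this)
  have hW'J : ∀ e ∈ W'.edges, e ∈ J := fun e he => by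
    have : e ∈ Q.erase s(t + ![3, -1], t + ![3, 0]) := by rw [← hW'e]; exact List.mem_toFinset.2 he
    exact Finset.mem_union_left _ (Finset.mem_union_right _ this)
  have hWv : ∀ k, W.getVert k ∈ vertsOf P := fun k => mem_vertsOf.2 ((hWs _).1 (W.getVert_mem_support k))
  have hW'v : ∀ k, W'.getVert k ∈ vertsOf Q := fun k => mem_vertsOf.2 ((hW's _).1 (W'.getVert_mem_support k))
  have hWedge : ∀ k, k < W.length → s(W.getVert k, W.getVert (k + 1)) ∈ J := by
    intro k hk
    have hlen : k < W.darts.length := by rw [SimpleGraph.Walk.length_darts]; exact hk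
    have hd : W.darts[k] ∈ W.darts := List.getElem_mem hlen
    rw [SimpleGraph.Walk.darts_getElem_eq_getVert k hlen] at hd
    exact hWJ _ (List.mem_map.2 ⟨_, hd, rfl⟩)
  have hW'edge : ∀ k, k < W'.length → s(W'.getVert k, W'.getVert (k + 1)) ∈ J := by
    intro k hk
    have hlen : k < W'.darts.length := by rw [SimpleGraph.Walk.length_darts]; exact hk
    have hd : W'.darts[k] ∈ W'.darts := List.getElem_mem hlen
    rw [SimpleGraph.Walk.darts_getElem_eq_getVert k hlen] at hd
    exact hW'J _ (List.mem_map.2 ⟨_, hd, rfl⟩)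
  -- the eight connector bonds
  have c1 : s(t + ![0, 0], t + ![1, 0]) ∈ J := by simp [hJdef, staggeredJoin']
  have c2 : s(t + ![1, 0], t + ![1, -1]) ∈ J := by simp [hJdef, staggeredJoin']
  have c3 : s(t + ![1, -1], t + ![2, -1]) ∈ J := by simp [hJdef, staggeredJoin']
  have c4 : s(t + ![2, -1], t + ![3, -1]) ∈ J := by simp [hJdef, staggeredJoin']
  have c5 : s(t + ![0, 1], t + ![1, 1]) ∈ J := by simp [hJdef, staggeredJoin']
  have c6 : s(t + ![1, 1], t + ![2, 1]) ∈ J := by simp [hJdef, staggeredJoin']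
  have c7 : s(t + ![2, 1], t + ![2, 0]) ∈ J := by simp [hJdef, staggeredJoin']
  have c8 : s(t + ![2, 0], t + ![3, 0]) ∈ J := by simp [hJdef, staggeredJoin']
  -- STEP 1: the `P`-arc, `u (i+1+k) = W_k`
  have hu2 : u (i + 2) = W.getVert 1 := by
    refine next_eq₄ (i := i) hu hJ (x := t + ![1, 1]) (y := W.getVert 1) (by rw [h1]; exact c5) ?_ ?_ h0
    · rw [h1]; have := hWedge 0 (by omega); rwa [Walk.getVert_zero] at this
    · intro he; exact f1m.1 (he ▸ hWv 1)
  have hP_arc : ∀ k, k ≤ n - 1 → u (i + 1 + k) = W.getVert k := fun k hk =>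
    hu.follows_path hJ W hW hWJ (i := i + 1) h1 (fun _ => by rw [show i + 1 + 1 = i + 2 by omega]; exact hu2) k (by omega)
  have hun : u (i + n) = t + ![0, 0] := by
    have := hP_arc (n - 1) le_rfl
    rw [show i + 1 + (n - 1) = i + n by omega, ← hWlen, Walk.getVert_length] at this; exact this
  have hun1 : u (i + n - 1) = W.getVert (n - 2) := by
    have := hP_arc (n - 2) (by omega); rwa [show i + 1 + (n - 2) = i + n - 1 by omega] at this
  -- STEP 2: the upper connector `t → (1,0) → (1,1) → (2,1) → c`
  have hWlast : s(t + ![0, 0], W.getVert (n - 2)) ∈ J := by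
    have := hWedge (n - 2) (by omega)
    rw [show n - 2 + 1 = n - 1 by omega, ← hWlen, Walk.getVert_length, Sym2.eq_swap] at this
    exact this
  have hA1 : u (i + n + 1) = t + ![1, 0] := by
    have := next_eq₄ (i := i + n - 1) hu hJ (x := W.getVert (n - 2)) (y := t + ![1, 0])
      (by rw [show i + n - 1 + 1 = i + n by omega, hun]; exact hWlast) (by rw [show i + n - 1 + 1 = i + n by omega, hun]; exact c1)
      (fun he => f10.1 (he ▸ hWv (n - 2))) hun1
    rwa [show i + n - 1 + 2 = i + n + 1 by omega] at this
  have hA2 : u (i + n + 2) = t + ![1, -1] :=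
    next_eq₄ (i := i + n) hu hJ (x := t + ![0, 0]) (y := t + ![1, -1]) (by rw [hA1, Sym2.eq_swap]; exact c1) (by rw [hA1]; exact c2)
      (off_ne₄ (by decide)) hun
  have hA3 : u (i + n + 3) = t + ![2, -1] :=
    next_eq₄ (i := i + n + 1) hu hJ (x := t + ![1, 0]) (y := t + ![2, -1]) (by rw [hA2, Sym2.eq_swap]; exact c2) (by rw [hA2]; exact c3)
      (off_ne₄ (by decide)) hA1
  have hA4 : u (i + n + 4) = t + ![3, -1] :=
    next_eq₄ (i := i + n + 2) hu hJ (x := t + ![1, -1]) (y := t + ![3, -1]) (by rw [hA3, Sym2.eq_swap]; exact c3) (by rw [hA3]; exact c4)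
      (off_ne₄ (by decide)) hA2
  -- STEP 3: the `Q`-arc
  have hA5 : u (i + n + 5) = W'.getVert 1 := by
    refine next_eq₄ (i := i + n + 3) hu hJ (x := t + ![2, -1]) (y := W'.getVert 1) (by rw [hA4, Sym2.eq_swap]; exact c4) ?_ ?_ hA3
    · rw [hA4]; have := hW'edge 0 (by omega); rwa [Walk.getVert_zero] at this
    · intro he; exact f21.2 (he ▸ hW'v 1)
  have hQ_arc : ∀ k, k ≤ n - 1 → u (i + n + 4 + k) = W'.getVert k := fun k hk =>
    hu.follows_path hJ W' hW' hW'J (i := i + n + 4) hA4 (fun _ => by rw [show i + n + 4 + 1 = i + n + 5 by omega]; exact hA5) k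
      (by omega)
  have hud : u (i + 2 * n + 3) = t + ![3, 0] := by
    have := hQ_arc (n - 1) le_rfl
    rw [show i + n + 4 + (n - 1) = i + 2 * n + 3 by omega, ← hW'len, Walk.getVert_length] at this; exact this
  have hud1 : u (i + 2 * n + 2) = W'.getVert (n - 2) := by
    have := hQ_arc (n - 2) (by omega); rwa [show i + n + 4 + (n - 2) = i + 2 * n + 2 by omega] at this
  -- STEP 4: the lower connector `d → (2,0) → (2,−1) → (1,−1)`
  have hW'last : s(t + ![3, 0], W'.getVert (n - 2)) ∈ J := by
    have := hW'edge (n - 2) (by omega)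
    rw [show n - 2 + 1 = n - 1 by omega, ← hW'len, Walk.getVert_length, Sym2.eq_swap] at this
    exact this
  have hB1 : u (i + 2 * n + 4) = t + ![2, 0] := by
    have := next_eq₄ (i := i + 2 * n + 2) hu hJ (x := W'.getVert (n - 2)) (y := t + ![2, 0])
      (by rw [show i + 2 * n + 2 + 1 = i + 2 * n + 3 by omega, hud]; exact hW'last)
      (by rw [show i + 2 * n + 2 + 1 = i + 2 * n + 3 by omega, hud, Sym2.eq_swap]; exact c8)
      (fun he => f20.2 (he ▸ hW'v (n - 2))) hud1
    rwa [show i + 2 * n + 2 + 2 = i + 2 * n + 4 by omega] at this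
  have hB2 : u (i + 2 * n + 5) = t + ![2, 1] := by
    have := next_eq₄ (i := i + 2 * n + 3) hu hJ (x := t + ![3, 0]) (y := t + ![2, 1]) (by rw [hB1]; exact c8)
      (by rw [hB1, Sym2.eq_swap]; exact c7) (off_ne₄ (by decide)) hud
    rwa [show i + 2 * n + 3 + 2 = i + 2 * n + 5 by omega] at this
  have hB3 : u (i + 2 * n + 6) = t + ![1, 1] := by rw [show i + 2 * n + 6 = i + (2 * n + 6) by omega, hu.periodic, h0]
  -- the cut
  refine isStagCut_of_eqs_mirror t h1 (by rw [show i + 1 + (n + 3) - 4 = i + n by omega, hun])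
    (by rw [show i + 1 + (n + 3) - 3 = i + n + 1 by omega, hA1]) (by rw [show i + 1 + (n + 3) - 2 = i + n + 2 by omega, hA2])
    (by rw [show i + 1 + (n + 3) - 1 = i + n + 3 by omega, hA3]) (by rw [show i + 1 + (n + 3) = i + n + 4 by omega, hA4])
    (by rw [show i + 1 + 2 * (n + 3) - 4 = i + 2 * n + 3 by omega, hud]) (by rw [show i + 1 + 2 * (n + 3) - 3 = i + 2 * n + 4 by omega, hB1])
    (by rw [show i + 1 + 2 * (n + 3) - 2 = i + 2 * n + 5 by omega, hB2]) (by rw [show i + 1 + 2 * (n + 3) - 1 = i + 2 * n + 6 by omega, hB3]) ?_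
  -- row separation of the two blocks
  intro a b ha1 ha2 hb1 hb2 hrow
  have haL : u a ∈ vertsOf P ∨ (u a = t + ![1, 0] ∨ u a = t + ![1, -1] ∨ u a = t + ![2, -1]) := by
    rcases Nat.lt_or_ge a (i + n + 1) with hlt | hge
    · left
      have := hP_arc (a - (i + 1)) (by omega)
      rw [show i + 1 + (a - (i + 1)) = a by omega] at this
      rw [this]; exact hWv _
    · right
      rcases Nat.lt_or_ge a (i + n + 2) with h1' | h1'
      · left; rw [show a = i + n + 1 by omega]; exact hA1
      rcases Nat.lt_or_ge a (i + n + 3) with h2' | h2'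
      · right; left; rw [show a = i + n + 2 by omega]; exact hA2
      · right; right; rw [show a = i + n + 3 by omega]; exact hA3
  have hbR : u b ∈ vertsOf Q ∨ (u b = t + ![2, 0] ∨ u b = t + ![2, 1] ∨ u b = t + ![1, 1]) := by
    rcases Nat.lt_or_ge b (i + 2 * n + 4) with hlt | hge
    · left
      have := hQ_arc (b - (i + n + 4)) (by omega)
      rw [show i + n + 4 + (b - (i + n + 4)) = b by omega] at this
      rw [this]; exact hW'v _
    · right
      rcases Nat.lt_or_ge b (i + 2 * n + 5) with h1' | h1'
      · left; rw [show b = i + 2 * n + 4 by omega]; exact hB1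
      rcases Nat.lt_or_ge b (i + 2 * n + 6) with h2' | h2'
      · right; left; rw [show b = i + 2 * n + 5 by omega]; exact hB2
      · right; right; rw [show b = i + 2 * n + 6 by omega]; exact hB3
  rcases haL with haP | hj <;> rcases hbR with hbQ | hj'
  · exact lt_of_lt_of_le (by omega) (hK1 _ haP _ hbQ (Or.inl hrow))
  · -- `u a ∈ P` against a lower-connector site: corridor against `d = t + (3,0) ∈ Q`, and `t + (1,−1)` is free
    rcases hj' with hbE | hbE | hbE <;> rw [hbE] at hrow ⊢
    · have := hK1 _ haP _ dQ (by simp at hrow ⊢; omega); simp at this ⊢; omega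
    · have := hK1 _ haP _ dQ (by simp at hrow ⊢; omega); simp at this ⊢; omega
    · have := hK1 _ haP _ dQ (by simp at hrow ⊢; omega)
      simp at this hrow ⊢
      rcases lt_or_eq_of_le (show u a 0 ≤ t 0 + 1 by omega) with hlt | heq
      · omega
      · exact absurd haP (by rw [eq_off₄ (t := t) heq hrow]; exact f1m.1)
  · -- an upper-connector site against `u b ∈ Q`: corridor against `t ∈ P`, and `t + (2,1)` is free
    rcases hj with haE | haE | haE <;> rw [haE] at hrow ⊢
    · have := hK1 _ tP _ hbQ (by simp at hrow ⊢; omega); simp at this ⊢; omega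
    · have := hK1 _ tP _ hbQ (by simp at hrow ⊢; omega); simp at this ⊢; omega
    · have := hK1 _ tP _ hbQ (by simp at hrow ⊢; omega)
      simp at this hrow ⊢
      rcases lt_or_eq_of_le (show t 0 + 2 ≤ u b 0 by omega) with hlt | heq
      · omega
      · exact absurd hbQ (by rw [eq_off₄ (t := t) heq.symm hrow.symm]; exact f21.2)
  · rcases hj with haE | haE | haE <;> rcases hj' with hbE | hbE | hbE <;> rw [haE, hbE] at hrow ⊢ <;>
      (simp only [Pi.add_apply, uw0, uw1] at hrow ⊢; omega)

set_option maxHeartbeats 400000 in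
/-- **A T4′ decomposition imposes the BACKWARD staggered cut on the mirror of every traversal leaving `u = t + (0,1)` towards `t + (1,1)`.** [cite: Hammond2015SAPJoining, §4.2 pp. 20–24 (arXiv v5); Madras1995LatticeAnimalsExponent, §2] -/
theorem isStagCut'_of_isT4 (hu : IsPolyTraversal brickWallGraph (staggeredJoin' t P Q) (2 * n + 6) u) {i : ℕ} (h0 : u i = t + ![0, 1])
    (h1 : u (i + 1) = t + ![1, 1]) : IsStagCut' (n + 3) (fun k => ![u k 0, -(u k 1)]) (i + 1) := by
  classical
  have hdisj := disjoint_of_corridor (P := P) (Q := Q) hK1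
  obtain ⟨hJ, -⟩ := h.isPolygon_join hP hQ hdisj
  set J := staggeredJoin' t P Q with hJdef
  have tP : t + ![0, 0] ∈ vertsOf P := mem_vertsOf.2 ⟨_, h.het, by simp⟩
  have dQ : t + ![3, 0] ∈ vertsOf Q := mem_vertsOf.2 ⟨_, h.hew, by simp⟩
  have f10 := h.hfree (1, 0) (by simp [staggeredFree']); have f11 := h.hfree (1, -1) (by simp [staggeredFree'])
  have f21 := h.hfree (2, -1) (by simp [staggeredFree']); have f1m := h.hfree (1, 1) (by simp [staggeredFree'])
  have f2m := h.hfree (2, 1) (by simp [staggeredFree']); have f20 := h.hfree (2, 0) (by simp [staggeredFree'])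
  -- open `P` at `t – u` (path `t → … → u`) and `Q` at `d – c` (path `d → … → c`)
  obtain ⟨W, hW, hWe, -, hWl, hWs⟩ := hP.exists_isPath_erase h.het
  have hew' : s(t + ![3, 0], t + ![3, -1]) ∈ Q := by rw [Sym2.eq_swap]; exact h.hew
  obtain ⟨W', hW', hW'e, -, hW'l, hW's⟩ := hQ.exists_isPath_erase hew'
  have hWlen : W.length = n - 1 := by omega
  have hW'len : W'.length = n - 1 := by omega
  have hWJ : ∀ e ∈ W.edges, e ∈ J := fun e he => by
    have : e ∈ P.erase s(t + ![0, 0], t + ![0, 1]) := by rw [← hWe]; exact List.mem_toFinset.2 he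
    exact Finset.mem_union_left _ (Finset.mem_union_left _ this)
  have hW'J : ∀ e ∈ W'.edges, e ∈ J := fun e he => by
    have : e ∈ Q.erase s(t + ![3, -1], t + ![3, 0]) := by rw [Sym2.eq_swap, ← hW'e]; exact List.mem_toFinset.2 he
    exact Finset.mem_union_left _ (Finset.mem_union_right _ this)
  have hWv : ∀ k, W.getVert k ∈ vertsOf P := fun k => mem_vertsOf.2 ((hWs _).1 (W.getVert_mem_support k))
  have hW'v : ∀ k, W'.getVert k ∈ vertsOf Q := fun k => mem_vertsOf.2 ((hW's _).1 (W'.getVert_mem_support k))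
  have hWedge : ∀ k, k < W.length → s(W.getVert k, W.getVert (k + 1)) ∈ J := by
    intro k hk
    have hlen : k < W.darts.length := by rw [SimpleGraph.Walk.length_darts]; exact hk
    have hd : W.darts[k] ∈ W.darts := List.getElem_mem hlen
    rw [SimpleGraph.Walk.darts_getElem_eq_getVert k hlen] at hd
    exact hWJ _ (List.mem_map.2 ⟨_, hd, rfl⟩)
  have hW'edge : ∀ k, k < W'.length → s(W'.getVert k, W'.getVert (k + 1)) ∈ J := by
    intro k hk
    have hlen : k < W'.darts.length := by rw [SimpleGraph.Walk.length_darts]; exact hk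
    have hd : W'.darts[k] ∈ W'.darts := List.getElem_mem hlen
    rw [SimpleGraph.Walk.darts_getElem_eq_getVert k hlen] at hd
    exact hW'J _ (List.mem_map.2 ⟨_, hd, rfl⟩)
  have c1 : s(t + ![0, 0], t + ![1, 0]) ∈ J := by simp [hJdef, staggeredJoin']
  have c2 : s(t + ![1, 0], t + ![1, -1]) ∈ J := by simp [hJdef, staggeredJoin']
  have c3 : s(t + ![1, -1], t + ![2, -1]) ∈ J := by simp [hJdef, staggeredJoin']
  have c4 : s(t + ![2, -1], t + ![3, -1]) ∈ J := by simp [hJdef, staggeredJoin']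
  have c5 : s(t + ![0, 1], t + ![1, 1]) ∈ J := by simp [hJdef, staggeredJoin']
  have c6 : s(t + ![1, 1], t + ![2, 1]) ∈ J := by simp [hJdef, staggeredJoin']
  have c7 : s(t + ![2, 1], t + ![2, 0]) ∈ J := by simp [hJdef, staggeredJoin']
  have c8 : s(t + ![2, 0], t + ![3, 0]) ∈ J := by simp [hJdef, staggeredJoin']
  -- STEP 1: the lower connector `(1,−1) → (2,−1) → (2,0) → d`
  have hB1 : u (i + 2) = t + ![2, 1] :=
    next_eq₄ (i := i) hu hJ (x := t + ![0, 1]) (y := t + ![2, 1]) (by rw [h1, Sym2.eq_swap]; exact c5) (by rw [h1]; exact c6)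
      (off_ne₄ (by decide)) h0
  have hB2 : u (i + 3) = t + ![2, 0] :=
    next_eq₄ (i := i + 1) hu hJ (x := t + ![1, 1]) (y := t + ![2, 0]) (by rw [hB1, Sym2.eq_swap]; exact c6) (by rw [hB1]; exact c7)
      (off_ne₄ (by decide)) h1
  have hB3 : u (i + 4) = t + ![3, 0] :=
    next_eq₄ (i := i + 2) hu hJ (x := t + ![2, 1]) (y := t + ![3, 0]) (by rw [hB2, Sym2.eq_swap]; exact c7) (by rw [hB2]; exact c8)
      (off_ne₄ (by decide)) hB1
  -- STEP 2: the `Q`-arc backwards, `u (i+4+k) = W'_k`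
  have hB4 : u (i + 5) = W'.getVert 1 := by
    refine next_eq₄ (i := i + 3) hu hJ (x := t + ![2, 0]) (y := W'.getVert 1) (by rw [hB3, Sym2.eq_swap]; exact c8) ?_ ?_ hB2
    · rw [hB3]; have := hW'edge 0 (by omega); rwa [Walk.getVert_zero] at this
    · intro he; exact f20.2 (he ▸ hW'v 1)
  have hQ_arc : ∀ k, k ≤ n - 1 → u (i + 4 + k) = W'.getVert k := fun k hk =>
    hu.follows_path hJ W' hW' hW'J (i := i + 4) hB3 (fun _ => by rw [show i + 4 + 1 = i + 5 by omega]; exact hB4) k (by omega)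
  have huc : u (i + n + 3) = t + ![3, -1] := by
    have := hQ_arc (n - 1) le_rfl
    rw [show i + 4 + (n - 1) = i + n + 3 by omega, ← hW'len, Walk.getVert_length] at this; exact this
  have huc1 : u (i + n + 2) = W'.getVert (n - 2) := by
    have := hQ_arc (n - 2) (by omega); rwa [show i + 4 + (n - 2) = i + n + 2 by omega] at this
  -- STEP 3: the upper connector backwards `c → (2,1) → (1,1) → (1,0) → t`
  have hW'last : s(t + ![3, -1], W'.getVert (n - 2)) ∈ J := by
    have := hW'edge (n - 2) (by omega)
    rw [show n - 2 + 1 = n - 1 by omega, ← hW'len, Walk.getVert_length, Sym2.eq_swap] at this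
    exact this
  have hA1 : u (i + n + 4) = t + ![2, -1] := by
    have := next_eq₄ (i := i + n + 2) hu hJ (x := W'.getVert (n - 2)) (y := t + ![2, -1])
      (by rw [show i + n + 2 + 1 = i + n + 3 by omega, huc]; exact hW'last)
      (by rw [show i + n + 2 + 1 = i + n + 3 by omega, huc, Sym2.eq_swap]; exact c4)
      (fun he => f21.2 (he ▸ hW'v (n - 2))) huc1
    rwa [show i + n + 2 + 2 = i + n + 4 by omega] at this
  have hA2 : u (i + n + 5) = t + ![1, -1] := by
    have := next_eq₄ (i := i + n + 3) hu hJ (x := t + ![3, -1]) (y := t + ![1, -1]) (by rw [hA1]; exact c4)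
      (by rw [hA1, Sym2.eq_swap]; exact c3) (off_ne₄ (by decide)) huc
    rwa [show i + n + 3 + 2 = i + n + 5 by omega] at this
  have hA3 : u (i + n + 6) = t + ![1, 0] := by
    have := next_eq₄ (i := i + n + 4) hu hJ (x := t + ![2, -1]) (y := t + ![1, 0]) (by rw [hA2]; exact c3)
      (by rw [hA2, Sym2.eq_swap]; exact c2) (off_ne₄ (by decide)) hA1
    rwa [show i + n + 4 + 2 = i + n + 6 by omega] at this
  have hA4 : u (i + n + 7) = t + ![0, 0] := by
    have := next_eq₄ (i := i + n + 5) hu hJ (x := t + ![1, -1]) (y := t + ![0, 0]) (by rw [hA3]; exact c2)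
      (by rw [hA3, Sym2.eq_swap]; exact c1) (off_ne₄ (by decide)) hA2
    rwa [show i + n + 5 + 2 = i + n + 7 by omega] at this
  -- STEP 4: the `P`-arc backwards, `u (i+n+7+k) = W_k`
  have hA5 : u (i + n + 8) = W.getVert 1 := by
    have := next_eq₄ (i := i + n + 6) hu hJ (x := t + ![1, 0]) (y := W.getVert 1)
      (by rw [show i + n + 6 + 1 = i + n + 7 by omega, hA4]; exact c1) ?_ ?_ hA3
    · rwa [show i + n + 6 + 2 = i + n + 8 by omega] at this
    · rw [show i + n + 6 + 1 = i + n + 7 by omega, hA4]; have := hWedge 0 (by omega); rwa [Walk.getVert_zero] at this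
    · intro he; exact f10.1 (he ▸ hWv 1)
  have hP_arc : ∀ k, k ≤ n - 1 → u (i + n + 7 + k) = W.getVert k := fun k hk =>
    hu.follows_path hJ W hW hWJ (i := i + n + 7) hA4 (fun _ => by rw [show i + n + 7 + 1 = i + n + 8 by omega]; exact hA5) k (by omega)
  have huu : u (i + 2 * n + 6) = t + ![0, 1] := by
    have := hP_arc (n - 1) le_rfl
    rw [show i + n + 7 + (n - 1) = i + 2 * n + 6 by omega, ← hWlen, Walk.getVert_length] at this; exact this
  -- the backward cut
  refine isStagCut'_of_eqs_mirror t h1 (by rw [show i + 1 + 1 = i + 2 by omega, hB1]) (by rw [show i + 1 + 2 = i + 3 by omega, hB2])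
    (by rw [show i + 1 + 3 = i + 4 by omega, hB3]) (by rw [show i + 1 + (n + 3) - 1 = i + n + 3 by omega, huc])
    (by rw [show i + 1 + (n + 3) = i + n + 4 by omega, hA1]) (by rw [show i + 1 + (n + 3) + 1 = i + n + 5 by omega, hA2])
    (by rw [show i + 1 + (n + 3) + 2 = i + n + 6 by omega, hA3]) (by rw [show i + 1 + (n + 3) + 3 = i + n + 7 by omega, hA4])
    (by rw [show i + 1 + 2 * (n + 3) - 1 = i + 2 * n + 6 by omega, huu]) ?_
  -- separation: the first block (lower connector, `Q`-arc) lies right of the second (upper connector, `P`-arc)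
  intro a b ha1 ha2 hb1 hb2 hrow
  have haR : u a ∈ vertsOf Q ∨ (u a = t + ![1, 1] ∨ u a = t + ![2, 1] ∨ u a = t + ![2, 0]) := by
    rcases Nat.lt_or_ge a (i + 4) with hlt | hge
    · right
      rcases Nat.lt_or_ge a (i + 2) with h1' | h1'
      · left; rw [show a = i + 1 by omega]; exact h1
      rcases Nat.lt_or_ge a (i + 3) with h2' | h2'
      · right; left; rw [show a = i + 2 by omega]; exact hB1
      · right; right; rw [show a = i + 3 by omega]; exact hB2
    · left
      have := hQ_arc (a - (i + 4)) (by omega)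
      rw [show i + 4 + (a - (i + 4)) = a by omega] at this
      rw [this]; exact hW'v _
  have hbL : u b ∈ vertsOf P ∨ (u b = t + ![2, -1] ∨ u b = t + ![1, -1] ∨ u b = t + ![1, 0]) := by
    rcases Nat.lt_or_ge b (i + n + 7) with hlt | hge
    · right
      rcases Nat.lt_or_ge b (i + n + 5) with h1' | h1'
      · left; rw [show b = i + n + 4 by omega]; exact hA1
      rcases Nat.lt_or_ge b (i + n + 6) with h2' | h2'
      · right; left; rw [show b = i + n + 5 by omega]; exact hA2
      · right; right; rw [show b = i + n + 6 by omega]; exact hA3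
    · left
      have := hP_arc (b - (i + n + 7)) (by omega)
      rw [show i + n + 7 + (b - (i + n + 7)) = b by omega] at this
      rw [this]; exact hWv _
  rcases haR with haQ | hj <;> rcases hbL with hbP | hj'
  · exact lt_of_lt_of_le (by omega) (hK1 _ hbP _ haQ (Or.inl hrow.symm))
  · -- `u a ∈ Q` against an upper-connector site
    rcases hj' with hbE | hbE | hbE <;> rw [hbE] at hrow ⊢
    · have := hK1 _ tP _ haQ (by simp at hrow ⊢; omega)
      simp at this hrow ⊢
      rcases lt_or_eq_of_le (show t 0 + 2 ≤ u a 0 by omega) with hlt | heq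
      · omega
      · exact absurd haQ (by rw [eq_off₄ (t := t) heq.symm hrow]; exact f21.2)
    · have := hK1 _ tP _ haQ (by simp at hrow ⊢; omega); simp at this ⊢; omega
    · have := hK1 _ tP _ haQ (by simp at hrow ⊢; omega); simp at this ⊢; omega
  · -- a lower-connector site against `u b ∈ P`
    rcases hj with haE | haE | haE <;> rw [haE] at hrow ⊢
    · have := hK1 _ hbP _ dQ (by simp at hrow ⊢; omega)
      simp at this hrow ⊢
      rcases lt_or_eq_of_le (show u b 0 ≤ t 0 + 1 by omega) with hlt | heq
      · omega
      · exact absurd hbP (by rw [eq_off₄ (t := t) heq hrow.symm]; exact f1m.1)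
    · have := hK1 _ hbP _ dQ (by simp at hrow ⊢; omega); simp at this ⊢; omega
    · have := hK1 _ hbP _ dQ (by simp at hrow ⊢; omega); simp at this ⊢; omega
  · rcases hj with haE | haE | haE <;> rcases hj' with hbE | hbE | hbE <;> rw [haE, hbE] at hrow ⊢ <;>
      (simp only [Pi.add_apply, uw0, uw1] at hrow ⊢; omega)

end Bridge

/-! ### Same polygon, two T4′ decompositions -/

/-- periodicity downwards for the forward cut (private plumbing). [cite: Hammond2015SAPJoining, Definition 4.3 p. 20 (arXiv v5)] -/
private theorem isStagCut_sub_period₄ {M j : ℕ} {v : ℕ → Site 2} (hM : 4 ≤ M) (hper : ∀ i, v (i + 2 * M) = v i)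
    (h : IsStagCut M v (j + 2 * M)) : IsStagCut M v j := by
  have h' : IsStagCut M (fun i => v (i + 2 * M)) j := isStagCut_shift hM (by rw [Nat.add_comm]; exact h)
  simp only [hper] at h'
  exact h'

/-- periodicity downwards for the backward cut (private plumbing). [cite: Hammond2015SAPJoining, Definition 4.3 p. 20 (arXiv v5)] -/
private theorem isStagCut'_sub_period₄ {M j : ℕ} {v : ℕ → Site 2} (hM : 4 ≤ M) (hper : ∀ i, v (i + 2 * M) = v i)
    (h : IsStagCut' M v (j + 2 * M)) : IsStagCut' M v j := by
  have h' : IsStagCut' M (fun i => v (i + 2 * M)) j := isStagCut'_shift hM (by rw [Nat.add_comm]; exact h)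
  simp only [hper] at h'
  exact h'

/-- **Junction uniqueness for the reflected staggered join, same polygon** (`d = 0`). [cite: Hammond2015SAPJoining, §4.2 pp. 20–24 (arXiv v5: the junction plaquette is determined); Madras1995LatticeAnimalsExponent, §2] -/
theorem staggeredJoin'_site_unique {P' Q' : Finset (Sym2 (Site 2))} {t' : Site 2}
    (hP : IsPolygon brickWallGraph P) (hQ : IsPolygon brickWallGraph Q) (hP' : IsPolygon brickWallGraph P') (hQ' : IsPolygon brickWallGraph Q')
    (hPn : #P = n) (hQn : #Q = n) (hP'n : #P' = n) (hQ'n : #Q' = n) (hn : 3 ≤ n) (hK1 : Corridor P Q) (hK1' : Corridor P' Q')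
    (h : IsT4 P Q t) (h' : IsT4 P' Q' t') (hJ : staggeredJoin' t' P' Q' = staggeredJoin' t P Q) : t' = t := by
  classical
  have hdisj := disjoint_of_corridor (P := P) (Q := Q) hK1
  obtain ⟨hJpoly, hJc⟩ := h.isPolygon_join hP hQ hdisj
  have hcard : #(staggeredJoin' t P Q) = 2 * n + 6 := by rw [hJc, hPn, hQn]; ring
  have c5 : s(t + ![1, 1], t + ![0, 1]) ∈ staggeredJoin' t P Q := by rw [Sym2.eq_swap]; simp [staggeredJoin']
  obtain ⟨u, hu, hu0, hu1⟩ := hJpoly.exists_isPolyTraversal c5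
  rw [hcard] at hu
  -- the mirrored traversal
  set v : ℕ → Site 2 := fun k => ![u k 0, -(u k 1)] with hv
  have hrowu : ∀ i, u (i + 1) 1 ≤ u i 1 + 1 ∧ u i 1 ≤ u (i + 1) 1 + 1 := row_step_le_of_adj hu.adj
  have hrow : ∀ i, v (i + 1) 1 ≤ v i 1 + 1 ∧ v i 1 ≤ v (i + 1) 1 + 1 := fun i => by
    have := hrowu i; simp only [hv, ux1]; omega
  have hper : ∀ i, v (i + 2 * (n + 3)) = v i := fun i => by
    simp only [hv, show 2 * (n + 3) = 2 * n + 6 by ring, hu.periodic]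
  have cut1 := isStagCut_of_isT4 hP hQ hPn hQn hn hK1 h hu (i := 0) hu0 (by simpa using hu1)
  simp only [Nat.zero_add] at cut1
  have c5' : s(t' + ![1, 1], t' + ![0, 1]) ∈ staggeredJoin' t P Q := by rw [← hJ, Sym2.eq_swap]; simp [staggeredJoin']
  obtain ⟨i, hi, hie⟩ := hu.surj _ c5'
  have hu' : IsPolyTraversal brickWallGraph (staggeredJoin' t' P' Q') (2 * n + 6) u := by rw [hJ]; exact hu
  rcases Sym2.eq_iff.1 hie with ⟨ha, hb⟩ | ⟨ha, hb⟩
  · have cut2 := isStagCut_of_isT4 hP' hQ' hP'n hQ'n hn hK1' h' hu' (i := i) ha hb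
    rcases Nat.lt_or_ge (i + 1) (2 * (n + 3)) with hlt | hge
    · have := isStagCut_unique (by omega) hper (by omega) hlt cut1 cut2
      have e : u 1 = u (i + 1) := by rw [← this]
      rw [hu1, hb] at e
      exact (add_right_cancel e).symm
    · have hi' : i + 1 = 0 + 2 * (n + 3) := by omega
      rw [hi'] at cut2
      have := isStagCut_unique (by omega) hper (by omega) (by omega) cut1 (isStagCut_sub_period₄ (by omega) hper cut2)
      omega
  · exfalso
    have cut2 := isStagCut'_of_isT4 hP' hQ' hP'n hQ'n hn hK1' h' hu' (i := i) ha hb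
    rcases Nat.lt_or_ge (i + 1) (2 * (n + 3)) with hlt | hge
    · exact not_isStagCut'_of_isStagCut (by omega) hper hrow (by omega) hlt cut1 cut2
    · have hi' : i + 1 = 0 + 2 * (n + 3) := by omega
      rw [hi'] at cut2
      exact not_isStagCut'_of_isStagCut (by omega) hper hrow (by omega) (by omega) cut1 (isStagCut'_sub_period₄ (by omega) hper cut2)

/-! ### Translation and `JU4` -/

/-- a bond translated (private plumbing). [folklore] -/
private theorem mem_shift_of_mem₄ {E : Finset (Sym2 (Site 2))} {a b d : Site 2} (h : s(a, b) ∈ E) : s(a + d, b + d) ∈ shiftEdges d E :=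
  mem_shiftEdges_iff.2 ⟨_, h, by rw [Sym2.map_mk]⟩

/-- offsets commute with the translation (private plumbing). [folklore] -/
private theorem add_off₄ (t d v : Site 2) : t + d + v = t + v + d := add_right_comm t d v

/-- The T4′ bundle is covariant under even translations. [cite: Hammond2015SAPJoining, Definition 4.3 p. 20 (arXiv v5)] -/
theorem isT4_shift (h : IsT4 P Q t) {d : Site 2} (hd : (d 0 + d 1) % 2 = 0) : IsT4 (shiftEdges d P) (shiftEdges d Q) (t + d) := by
  have nv : ∀ {E : Finset (Sym2 (Site 2))} {v : Site 2}, t + v ∉ vertsOf E → t + d + v ∉ vertsOf (shiftEdges d E) :=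
    fun {E} {v} hv hh => hv (by rw [mem_vertsOf_shiftEdges, add_off₄, add_sub_cancel_right] at hh; exact hh)
  refine ⟨?_, ?_, ?_, fun ab hab => ⟨nv (h.hfree ab hab).1, nv (h.hfree ab hab).2⟩⟩
  · have := h.hpar; simp only [Pi.add_apply]; omega
  · rw [add_off₄, add_off₄ t d]; exact mem_shift_of_mem₄ h.het
  · rw [add_off₄, add_off₄ t d]; exact mem_shift_of_mem₄ h.hew

/-- The reflected staggered join is covariant under even translations. [cite: Hammond2015SAPJoining, Definition 4.3 p. 20 (arXiv v5)] -/
theorem staggeredJoin'_shift (h : IsT4 P Q t) (hdisj : ∀ x, x ∈ vertsOf P → x ∈ vertsOf Q → False) {d : Site 2}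
    (hd : (d 0 + d 1) % 2 = 0) :
    staggeredJoin' (t + d) (shiftEdges d P) (shiftEdges d Q) = shiftEdges d (staggeredJoin' t P Q) := by
  classical
  have hdisj' : ∀ x, x ∈ vertsOf (shiftEdges d P) → x ∈ vertsOf (shiftEdges d Q) → False := fun x hx hy =>
    hdisj (x - d) (mem_vertsOf_shiftEdges.1 hx) (mem_vertsOf_shiftEdges.1 hy)
  rw [staggeredJoin'_eq_symmDiff (isT4_shift h hd) hdisj', staggeredJoin'_eq_symmDiff h hdisj, bdry_add]
  unfold shiftEdges
  rw [Finset.image_symmDiff _ _ (Sym2.map.injective (add_left_injective d)), Finset.image_union]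

/-- **`JU4` holds**: junction uniqueness for the reflected staggered double-brick join (type T4′). [cite: Hammond2015SAPJoining, §4.2 pp. 20–24 (arXiv v5: the junction plaquette is determined by the joined polygon); Madras1995LatticeAnimalsExponent, §2] -/
theorem ju4 : JU4 := by
  intro P Q P' Q' t t' d n hP hQ hP' hQ' hPn hQn hP'n hQ'n hK1 hK1' h h' hJ
  classical
  have hdisj := disjoint_of_corridor (P := P) (Q := Q) hK1
  have hn : 3 ≤ n := by
    obtain ⟨w, c, hc, hcE⟩ := hP
    rw [← hPn, ← hcE, List.toFinset_card_of_nodup hc.edges_nodup, Walk.length_edges]; exact hc.three_le_length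
  by_cases hd : (d 0 + d 1) % 2 = 0
  · have hPd := PolygonConcat.isPolygon_shiftEdges_of_even hP hd
    have hQd := PolygonConcat.isPolygon_shiftEdges_of_even hQ hd
    exact staggeredJoin'_site_unique (P := shiftEdges d P) (Q := shiftEdges d Q) (t := t + d) (n := n) hPd hQd hP' hQ'
      (by rw [card_shiftEdges, hPn]) (by rw [card_shiftEdges, hQn]) hP'n hQ'n hn (hK1.shift d) hK1' (isT4_shift h hd) h'
      (by rw [hJ, staggeredJoin'_shift h hdisj hd])
  · exfalso
    have c2 : s(t + ![1, 0], t + ![1, -1]) ∈ staggeredJoin' t P Q := by simp [staggeredJoin']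
    have hmemJ' : s(t + ![1, 0] + d, t + ![1, -1] + d) ∈ staggeredJoin' t' P' Q' := by rw [hJ]; exact mem_shift_of_mem₄ c2
    have hdisj' := disjoint_of_corridor (P := P') (Q := Q') hK1'
    have hJ'poly := (h'.isPolygon_join hP' hQ' hdisj').1
    have hadj : brickWallGraph.Adj (t + ![1, 0] + d) (t + ![1, -1] + d) := IsPolygon.mem_edgeSet hJ'poly hmemJ'
    rw [brickWallGraph_adj_coord] at hadj
    have ht := h.hpar
    simp only [Pi.add_apply] at hadj
    simp at hadj
    omega

end Assembly

end HexBW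

end Literature.Probability.RandomPlanarGeometry.SAW

end


/-!
# Madras' `θ ≥ 1/2` on the honeycomb lattice: `q_N(ℍ) ≤ A · N^{−1/2} · √(2+√2)^N`

Topic `Literature/Probability/RandomPlanarGeometry` (lane «pcv-sawmu», a-p4 g14; the last module of LINE «HEX-MADRAS»).

`HexSAWPolygonJoinAssembly.hexPolygonNumber_le_rpow_of_junctionUnique` proves the bound modulo
`JunctionUnique = JU1 ∧ JU2 ∧ JU3 ∧ JU4 ∧ JU5` (for each of the five capless junction types, a joined polygon of known type determines its
junction site); the five conjuncts are the theorems `ju1` (`HexSAWPolygonJunctionUniqueT1`), `ju2` (`…T2`), `ju3` (`…T3`), `ju4` (`…T4`),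
`ju5` (`…T5`).  This file puts them together.

* `HexBW.Assembly.junctionUnique : JunctionUnique`;
* **`HexBW.hexPolygonNumber_le_rpow_half`**: `∃ A, ∀ N ≥ 1, q_N(ℍ) ≤ A · N^{−1/2} · √(2+√2)^N` — the number of `N`-bond self-avoiding polygons of
  the honeycomb lattice up to translation is at most `A N^{−1/2} μ^N` with `μ = √(2+√2)` (Duminil-Copin–Smirnov); equivalently the polygon
  critical exponent satisfies `θ ≥ 1/2` on `ℍ` in Madras' sense;
* `HexBW.log_le_of_le_rpow_mul_pow` (generic), `HexBW.half_le_log_sqrt_two_add_sqrt_two`, and the exponent inequality in logarithmic form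
  **`HexBW.log_hexPolygonNumber_le`**: `∃ C, ∀ N ≥ 1, log q_N(ℍ) ≤ N · log √(2+√2) − ½ · log N + C` (Hammond's `θ_N ≥ 1/2 − C/log N`, §2 eq. (2.1);
  `log 0 = 0` covers the odd `N`, for which `q_N(ℍ) = 0`);
* `HexBW.card_saLoops_le_of_le_rpow_mul_pow` (generic) and the rooted form **`HexBW.card_saLoops_le_sqrt_mul_pow`**:
  `∃ A, ∀ N ≥ 1, #saLoops N ≤ A · √N · √(2+√2)^N` (Madras–Slade (3.2.1): `#saLoops N = N · q_N(ℍ)`, tree `card_saLoops_eq_mul_hexPolygonNumber`).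

Source frame.  N. Madras, J. Stat. Phys. 78 (1995) 681–699, §2: `q_N ≤ C N^{−1/2} μ^N` on `ℤ²` by joining pairs of polygons (primary source not
held by the lane; the statement is reported in A. Hammond, arXiv:1504.05286v5, §2 p. 4, whose §4.1 and Definition 4.3 p. 20 describe the Madras
join used here); H. Duminil-Copin and S. Smirnov, Ann. of Math. 175 (2012), Theorem 1 (`μ(ℍ) = √(2+√2)`).  The honeycomb edition with the explicit
constant-free form above is, as far as the lane's literature search found, NOT IN PRINT (label of LINE «HEX-MADRAS»: new in writing, technique
class Madras join).
-/

noncomputable section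

open Finset

namespace Literature.Probability.RandomPlanarGeometry.SAW

namespace HexBW

/-- **Junction uniqueness holds** for all five capless junction types of the Madras join on `ℍ`.
[cite: Hammond2015SAPJoining, §4.2 pp. 20–24 (arXiv v5: the junction plaquette is determined by the joined polygon); Madras1995LatticeAnimalsExponent, §2] -/
theorem Assembly.junctionUnique : Assembly.JunctionUnique :=
  ⟨Assembly.ju1, Assembly.ju2, Assembly.ju3, Assembly.ju4, Assembly.ju5⟩

/-- **Madras' `θ ≥ 1/2` on the honeycomb lattice**: there is a constant `A` with `q_N(ℍ) ≤ A · N^{−1/2} · √(2+√2)^N` for every `N ≥ 1`, where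
`q_N(ℍ) = hexPolygonNumber N` counts the `N`-bond self-avoiding polygons of the honeycomb lattice up to translation.
[cite: Madras1995LatticeAnimalsExponent, §2 (θ ≥ 1/2 in two dimensions; primary, not held)] [cite: Hammond2015SAPJoining, §2 p. 4 and §4.1,
Definition 4.3 p. 20 (arXiv v5: the polygon joining technique)] [cite: DuminilCopinSmirnov2012, Theorem 1 (μ = √(2+√2))] -/
theorem hexPolygonNumber_le_rpow_half :
    ∃ A : ℝ, ∀ N : ℕ, 1 ≤ N → (hexPolygonNumber N : ℝ) ≤ A * (N : ℝ) ^ (-(1 / 2 : ℝ)) * Real.sqrt (2 + Real.sqrt 2) ^ N :=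
  Assembly.hexPolygonNumber_le_rpow_of_junctionUnique Assembly.junctionUnique

/-- From `q_N ≤ A·N^{−1/2}·μ^N` (`N ≥ 1`) with `log μ ≥ 1/2` to `log q_N ≤ N·log μ − ½·log N + C` (`N ≥ 1`; `log 0 = 0`).
[cite: Hammond2015SAPJoining, §2 eq. (2.1) and p. 4 (arXiv v5: `p_n = n^{−θ_n} μ^n`, `θ_n ≥ 1/2 − o(1)`)] -/
theorem log_le_of_le_rpow_mul_pow {q : ℕ → ℕ} {μ : ℝ} (hμ : 1 / 2 ≤ Real.log μ) (hμ0 : 0 < μ)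
    (h : ∃ A : ℝ, ∀ N : ℕ, 1 ≤ N → (q N : ℝ) ≤ A * (N : ℝ) ^ (-(1 / 2 : ℝ)) * μ ^ N) :
    ∃ C : ℝ, ∀ N : ℕ, 1 ≤ N → Real.log (q N) ≤ N * Real.log μ - (1 / 2) * Real.log N + C := by
  obtain ⟨A, hA⟩ := h
  refine ⟨|Real.log A|, fun N hN => ?_⟩
  have hN0 : (0 : ℝ) < N := by exact_mod_cast hN
  have hlogN : Real.log N ≤ N := (Real.log_le_sub_one_of_pos hN0).trans (by linarith)
  by_cases hq : q N = 0
  · rw [hq, Nat.cast_zero, Real.log_zero]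
    nlinarith [abs_nonneg (Real.log A), Real.log_nonneg (show (1 : ℝ) ≤ N by exact_mod_cast hN)]
  · have hqpos : (0 : ℝ) < q N := by exact_mod_cast Nat.pos_of_ne_zero hq
    have hle := hA N hN
    have hpowN : (0 : ℝ) < (N : ℝ) ^ (-(1 / 2 : ℝ)) := Real.rpow_pos_of_pos hN0 _
    have hpowμ : (0 : ℝ) < μ ^ N := pow_pos hμ0 N
    have hApos : 0 < A := by
      by_contra hA0
      push Not at hA0
      have : A * (N : ℝ) ^ (-(1 / 2 : ℝ)) * μ ^ N ≤ 0 :=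
        mul_nonpos_of_nonpos_of_nonneg (mul_nonpos_of_nonpos_of_nonneg hA0 hpowN.le) hpowμ.le
      linarith
    calc Real.log (q N) ≤ Real.log (A * (N : ℝ) ^ (-(1 / 2 : ℝ)) * μ ^ N) := Real.log_le_log hqpos hle
      _ = Real.log A + -(1 / 2 : ℝ) * Real.log N + N * Real.log μ := by
          rw [Real.log_mul (mul_pos hApos hpowN).ne' hpowμ.ne', Real.log_mul hApos.ne' hpowN.ne', Real.log_rpow hN0, Real.log_pow]
      _ ≤ N * Real.log μ - 1 / 2 * Real.log N + |Real.log A| := by linarith [le_abs_self (Real.log A)]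

/-- `log √(2+√2) ≥ 1/2` (since `2 + √2 ≥ 3 > e`). [cite: DuminilCopinSmirnov2012, Theorem 1] -/
theorem half_le_log_sqrt_two_add_sqrt_two : 1 / 2 ≤ Real.log (Real.sqrt (2 + Real.sqrt 2)) := by
  have h2 : (1 : ℝ) ≤ Real.sqrt 2 := by rw [← Real.sqrt_one]; exact Real.sqrt_le_sqrt (by norm_num)
  have he : Real.exp 1 ≤ 2 + Real.sqrt 2 := by have := Real.exp_one_lt_d9; linarith
  have hpos : (0 : ℝ) < 2 + Real.sqrt 2 := by linarith
  rw [Real.log_sqrt hpos.le]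
  have : 1 ≤ Real.log (2 + Real.sqrt 2) := by
    rw [← Real.log_exp 1]; exact Real.log_le_log (Real.exp_pos 1) he
  linarith

/-- **The exponent inequality «θ(ℍ) ≥ 1/2» in logarithmic form**: `log q_N(ℍ) ≤ N·log √(2+√2) − ½·log N + C` for all `N ≥ 1`.
[cite: Madras1995LatticeAnimalsExponent, §2 (primary, not held)] [cite: Hammond2015SAPJoining, §2 eq. (2.1) and p. 4 (arXiv v5:
`θ_n ≥ 1/2 − o(1)` in two dimensions)] [cite: DuminilCopinSmirnov2012, Theorem 1] -/
theorem log_hexPolygonNumber_le :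
    ∃ C : ℝ, ∀ N : ℕ, 1 ≤ N →
      Real.log (hexPolygonNumber N) ≤ N * Real.log (Real.sqrt (2 + Real.sqrt 2)) - (1 / 2) * Real.log N + C :=
  log_le_of_le_rpow_mul_pow half_le_log_sqrt_two_add_sqrt_two (Real.sqrt_pos.2 (by positivity)) hexPolygonNumber_le_rpow_half

/-- From `q_N(ℍ) ≤ A·N^{−1/2}·μ^N` (`N ≥ 1`, `μ ≥ 1`) to the rooted form `#saLoops N ≤ A'·√N·μ^N` (`N ≥ 1`), by `#saLoops N = N·q_N(ℍ)` (`N ≥ 3`).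
[cite: MadrasSlade1993, §3.2 eq. (3.2.1) p. 63 (rooted oriented polygons vs. polygons up to translation)] -/
theorem card_saLoops_le_of_le_rpow_mul_pow {μ : ℝ} (hμ1 : 1 ≤ μ)
    (h : ∃ A : ℝ, ∀ N : ℕ, 1 ≤ N → (hexPolygonNumber N : ℝ) ≤ A * (N : ℝ) ^ (-(1 / 2 : ℝ)) * μ ^ N) :
    ∃ A : ℝ, ∀ N : ℕ, 1 ≤ N → (#(saLoops N) : ℝ) ≤ A * Real.sqrt N * μ ^ N := by
  classical
  obtain ⟨A, hA⟩ := h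
  -- small `N`: a crude constant
  set B : ℝ := (#(saLoops 1) : ℝ) + #(saLoops 2) with hB
  have hB0 : 0 ≤ B := by positivity
  refine ⟨max A 0 + B, fun N hN => ?_⟩
  have hN0 : (0 : ℝ) < N := by exact_mod_cast (show 0 < N by omega)
  have hs1 : 1 ≤ Real.sqrt N := by
    rw [show (1 : ℝ) = Real.sqrt 1 by simp]
    exact Real.sqrt_le_sqrt (by exact_mod_cast hN)
  have hμN : 1 ≤ μ ^ N := one_le_pow₀ hμ1
  have hfac : 1 ≤ Real.sqrt N * μ ^ N := one_le_mul_of_one_le_of_one_le hs1 hμN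
  by_cases h3 : 3 ≤ N
  · -- `#saLoops N = N q_N ≤ N · A N^{-1/2} μ^N = A √N μ^N`
    have hq := hA N hN
    have hμ0 : 0 ≤ μ ^ N := by positivity
    have hq' : (hexPolygonNumber N : ℝ) ≤ max A 0 * (N : ℝ) ^ (-(1 / 2 : ℝ)) * μ ^ N :=
      hq.trans (by gcongr; exact le_max_left _ _)
    have hL : (#(saLoops N) : ℝ) = N * hexPolygonNumber N := by
      exact_mod_cast card_saLoops_eq_mul_hexPolygonNumber h3
    have hrpow : (N : ℝ) * (N : ℝ) ^ (-(1 / 2 : ℝ)) = Real.sqrt N := by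
      rw [Real.rpow_neg hN0.le, ← Real.sqrt_eq_rpow]
      have hs : 0 < Real.sqrt (N : ℝ) := Real.sqrt_pos.2 hN0
      have hs2 : Real.sqrt (N : ℝ) * Real.sqrt N = N := Real.mul_self_sqrt hN0.le
      calc (N : ℝ) * (Real.sqrt N)⁻¹ = (Real.sqrt N * Real.sqrt N) * (Real.sqrt N)⁻¹ := by rw [hs2]
        _ = Real.sqrt N := by rw [mul_assoc, mul_inv_cancel₀ hs.ne', mul_one]
    calc (#(saLoops N) : ℝ) = N * hexPolygonNumber N := hL
      _ ≤ N * (max A 0 * (N : ℝ) ^ (-(1 / 2 : ℝ)) * μ ^ N) := by gcongr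
      _ = max A 0 * ((N : ℝ) * (N : ℝ) ^ (-(1 / 2 : ℝ))) * μ ^ N := by ring
      _ = max A 0 * Real.sqrt N * μ ^ N := by rw [hrpow]
      _ ≤ (max A 0 + B) * Real.sqrt N * μ ^ N := by
          have : 0 ≤ Real.sqrt N * μ ^ N := by positivity
          nlinarith
  · -- `N ∈ {1, 2}`
    have hsmall : (#(saLoops N) : ℝ) ≤ B := by
      interval_cases N
      · rw [hB]; exact le_add_of_nonneg_right (Nat.cast_nonneg _)
      · rw [hB]; exact le_add_of_nonneg_left (Nat.cast_nonneg _)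
    calc (#(saLoops N) : ℝ) ≤ B * 1 := by rw [mul_one]; exact hsmall
      _ ≤ B * (Real.sqrt N * μ ^ N) := mul_le_mul_of_nonneg_left hfac hB0
      _ ≤ (max A 0 + B) * Real.sqrt N * μ ^ N := by
          have : 0 ≤ max A 0 * (Real.sqrt N * μ ^ N) := mul_nonneg (le_max_right _ _) (by positivity)
          nlinarith

/-- **Madras' bound in the rooted normalisation on `ℍ`**: the rooted oriented `N`-bond honeycomb polygons through the origin (`HexBW.saLoops N`,
`#saLoops N = N·q_N(ℍ)`) number at most `A·√N·√(2+√2)^N` for all `N ≥ 1`.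
[cite: Madras1995LatticeAnimalsExponent, §2 (primary, not held)] [cite: MadrasSlade1993, §3.2 eq. (3.2.1) p. 63] [cite: DuminilCopinSmirnov2012, Theorem 1] -/
theorem card_saLoops_le_sqrt_mul_pow :
    ∃ A : ℝ, ∀ N : ℕ, 1 ≤ N → (#(saLoops N) : ℝ) ≤ A * Real.sqrt N * Real.sqrt (2 + Real.sqrt 2) ^ N :=
  card_saLoops_le_of_le_rpow_mul_pow (by rw [← Real.sqrt_one]; exact Real.sqrt_le_sqrt (by linarith [Real.sqrt_nonneg 2])) hexPolygonNumber_le_rpow_half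

end HexBW

end Literature.Probability.RandomPlanarGeometry.SAW

end

/-! ## `_holds` aliases (appended 2026-08-28)

The named fact(s) below are already theorems of the tree under another name; the `_holds`
alias records the discharge under the tree's naming convention (D-0026 bookkeeping: proof term =
the existing theorem, no statement or definition edited). -/

/-- `JU1` is a theorem of the tree (`Literature.Probability.RandomPlanarGeometry.SAW.HexBW.Assembly.ju1`). [cite: Hammond2015SAPJoining, §4.2 pp. 20–24 (arXiv v5: global join plaquettes); Madras1995LatticeAnimalsExponent, §2] -/
theorem _root_.Literature.Probability.RandomPlanarGeometry.SAW.HexBW.Assembly.JU1_holds : _root_.Literature.Probability.RandomPlanarGeometry.SAW.HexBW.Assembly.JU1 :=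
  _root_.Literature.Probability.RandomPlanarGeometry.SAW.HexBW.Assembly.ju1

/-- `JU2` is a theorem of the tree (`Literature.Probability.RandomPlanarGeometry.SAW.HexBW.Assembly.ju2`). [cite: Hammond2015SAPJoining, §4.2 pp. 20–24 (arXiv v5); Madras1995LatticeAnimalsExponent, §2] -/
theorem _root_.Literature.Probability.RandomPlanarGeometry.SAW.HexBW.Assembly.JU2_holds : _root_.Literature.Probability.RandomPlanarGeometry.SAW.HexBW.Assembly.JU2 :=
  _root_.Literature.Probability.RandomPlanarGeometry.SAW.HexBW.Assembly.ju2

/-- `JU4` is a theorem of the tree (`Literature.Probability.RandomPlanarGeometry.SAW.HexBW.Assembly.ju4`). [cite: Hammond2015SAPJoining, §4.2 pp. 20–24 (arXiv v5); Madras1995LatticeAnimalsExponent, §2] -/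
theorem _root_.Literature.Probability.RandomPlanarGeometry.SAW.HexBW.Assembly.JU4_holds : _root_.Literature.Probability.RandomPlanarGeometry.SAW.HexBW.Assembly.JU4 :=
  _root_.Literature.Probability.RandomPlanarGeometry.SAW.HexBW.Assembly.ju4

/-- `JunctionUnique` is a theorem of the tree (`Literature.Probability.RandomPlanarGeometry.SAW.HexBW.Assembly.junctionUnique`). [cite: Hammond2015SAPJoining, §4.2 pp. 20–24 (arXiv v5: «global join plaquettes»; here unique, by row separation); Madras1995LatticeAnimalsExponent, §2] -/
theorem _root_.Literature.Probability.RandomPlanarGeometry.SAW.HexBW.Assembly.JunctionUnique_holds : _root_.Literature.Probability.RandomPlanarGeometry.SAW.HexBW.Assembly.JunctionUnique :=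
  _root_.Literature.Probability.RandomPlanarGeometry.SAW.HexBW.Assembly.junctionUnique
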